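import Literature.AlgebraicGeometry.HodgeTheory.HodgeGroupExteriorAction
import Literature.AlgebraicGeometry.HodgeTheory.WeilTypePeriodPoint
import Literature.AlgebraicGeometry.HodgeTheory.ExteriorPullback
import Mathlib.LinearAlgebra.ExteriorPower.Basis
import Mathlib.LinearAlgebra.Dual.Lemmas
import Mathlib.LinearAlgebra.Matrix.Permutation
import Literature.AlgebraicGeometry.HodgeTheory.AbelianLowDimensionWeilReductionProofs
import Literature.AlgebraicGeometry.HodgeTheory.LefschetzOneOneHolds
import Literature.AlgebraicGeometry.HodgeTheory.ComplexConjugationHolds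
import Literature.AlgebraicGeometry.HodgeTheory.HodgeConjecture
import Literature.AlgebraicGeometry.HodgeTheory.WeilTypeHodgeRing
import HarnessLib

/-!
# Van Geemen 1994, Theorem 6.12 (Weil 1977): the Hodge ring of an abelian variety of Weil type with
# special Mumford–Tate group `SU_H` — the corrected statement (`n ≥ 2`), PROVED on the carriers

Research route conditional on HC_CM; not a corollary; Q11.4-sentence-2 already refuted in dim ≥ 3.
(Cell framing line of `pub-hodge-ring2`; this file is pure Literature: no Summit import, no new fact.)

## What is proved

`VanGeemen1994_thm612_corrected_holds : VanGeemen1994_thm612_corrected` — for a complex abelian variety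
`A` of dimension `2n` with **`2 ≤ n`**, `φ : A ⟶ A` with `φ ≫ φ = -d` (`d ≥ 1`), Weil classes of Hodge
type `(n,n)`, a `K`-symmetrised hyperplane class `h = d·e^*a + φ^*e^*a` (`a` rational, `≠ 0`) and
`HasHodgeGroupSU A φ n d h` ("the special Mumford–Tate group is `SU_H`", van Geemen 6.11 for the
general member): (i) `dim_ℂ Bᵖ ⊗ ℂ = 1` for `p ≤ 2n`, `p ≠ n`; (ii) `dim_ℂ Bⁿ ⊗ ℂ = 3`;
(iii) `Bᵖ ⊗ ℂ = Dᵖ ⊗ ℂ` (`p ≠ n`); (iv) `Bⁿ ⊗ ℂ = Dⁿ ⊗ ℂ ⊔ W_K ⊗ ℂ` with the summands disjoint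
[cite: vanGeemen1994HodgeAV, Thm. 6.12 and its proof].

## Why "corrected"

The tree's named fact `VanGeemen1994.VanGeemen1994_thm612` (file `WeilTypeHodgeGroupSU`) quantifies
over `0 < n`. For `n = 1` (abelian SURFACES of Weil type, e.g. `E × E` with `φ = (0,-d;1,0)`, for
which `Hg|_{H¹} = SL₂ = SU_H`) its hypotheses are satisfiable while its last conjunct
`Disjoint (D¹ ⊗ ℂ) (W_K ⊗ ℂ)` is false: `divisorMonomials _ _ 1 = {1 ∪ b}` makes `D¹ ⊗ ℂ = B¹ ⊗ ℂ`, which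
contains the non-zero plane `W_K ⊗ ℂ` (`weilClassesOf_eq_span_isRationalClass` under the Weil-type
hypothesis). Van Geemen's Theorem 4.11, of which 6.12 is the refinement, carries the printed proviso
"(with `n > 1`)" [cite: vanGeemen1994HodgeAV, Thm. 4.11]; Theorem 6.12's `Bⁿ = Dⁿ ⊕ ⋀_K^{2n}` with
`dim Bⁿ = 3` presupposes `dim Dⁿ = 1`, i.e. `B¹ = ℚ`, again `n > 1`. We therefore vendor the statement
with `2 ≤ n` under a NEW name and PROVE it; the old def is left untouched (its meaning is not edited).

## Architecture of the proof (van Geemen, proof of Thm. 6.12, made sign-free)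

* **A.** `Q = Q_{h_K}` is non-degenerate on `V = H¹(A(ℂ); ℂ)` (positivity of the period point,
  `exists_pos_polarizationPairingOne_weilOperatorOne`, and conjugation-stability of the kernel);
  the eigenspaces `W = ker(φ^* - i√d)`, `W̄ = ker(φ^* + i√d)` are `Q`-isotropic
  (`Q(φ^*x, φ^*y) = d Q(x,y)`) [cite: vanGeemen1994HodgeAV, Lemma 5.2 (2)].
* **B.** `W̄ ≅ W^*` through `ℓ ∘ Q` (`ℓ` the coordinate of the top line), dual bases `w`, `w^*`
  ("`V_ℂ = W ⊕ W^*`") [cite: vanGeemen1994HodgeAV, proof of Thm. 6.12].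
* **C.** Monomial automorphisms `wᵢ ↦ cᵢ w_{σ i}`, `w^*ᵢ ↦ c'ᵢ w^*_{σ i}` with `cᵢ c'ᵢ = 1`,
  `sign σ ∏ cᵢ = 1` lie in `SU_H(ℂ)` (commute with `φ^*`, preserve `Q`, `det = 1` on `W` and `W̄` by a
  monomial-determinant computation): the diagonal torus of `SL(W)` and signed transpositions
  [cite: vanGeemen1994HodgeAV, Lemma 6.10].
* **D.** `H^q(A(ℂ); ℂ) = ⋀^q H¹` has the monomial basis of the Weil basis (Mathlib
  `Module.Basis.exteriorPower`, the tree's `abelianVarietyCohomologyExteriorH1_holds`); a Hodge-group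
  element acts on `H^q` by the exterior action of its `H¹`-component
  (`HodgeTheory.hodgeGroup_apply_cupPowOne`, van Geemen 6.5), so under `Hg = SU_H` every class of
  `Bᵖ ⊗ ℂ` is fixed by `⋀^{2p}u`, `u ∈ SU_H(ℂ)` [cite: vanGeemen1994HodgeAV, 6.5–6.7].
* **E.** Torus weights kill every coordinate of an invariant class at a monomial that is neither
  PAIRED (`wᵢ` occurs iff `w^*ᵢ` occurs) nor a TOP (`w₁∧⋯∧w_{2n}`, `w^*₁∧⋯∧w^*_{2n}`); signed
  transpositions permute the paired monomials transitively. Hence an invariant class with vanishing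
  coordinate at ONE paired monomial and at the tops is zero (uniqueness lemma `eq_zero_of_invariant`).
* **F.** `h_K = α Σᵢ wᵢ ∪ w^*ᵢ` with `α ≠ 0`; `h_K^p ≠ 0` for `p ≤ 2n`
  (`L^{2n-1}_{h_K} h_K = 2nα · ω_A`); the top coordinates of `h_Kⁿ` vanish (a scaling element of
  `U_H`); the tops span `W_K ⊗ ℂ = E₊ ⊔ E₋`. The conclusions follow by the uniqueness lemma.

No representation theory of `SL(2n)` (Fulton–Harris) is needed: the torus and the transpositions suffice.

## References

* [vanGeemen1994HodgeAV] B. van Geemen, *An introduction to the Hodge conjecture for abelian varieties*,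
  LNM 1594 (1994): Lemma 5.2, 6.4–6.7, 6.9–6.12, Thm. 4.11.
* [Weil1977HodgeRing] A. Weil, *Abelian varieties and the Hodge ring*, Œuvres III [1977c].
* [LangeBirkenhake1992] H. Lange, Ch. Birkenhake, *Complex Abelian Varieties*, Lemma 1.1.17, Exercise 1.1.6.
* [Deligne1982HodgeCycles] P. Deligne, *Hodge cycles on abelian varieties*, LNM 900, §3–§4.
-/

noncomputable section

open CategoryTheory
open Literature.AlgebraicTopology.SingularHomology
open Literature.AlgebraicGeometry.Motives
open Literature.AlgebraicGeometry.HodgeTheory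
open Literature.Geometry.Kaehler

namespace Literature.AlgebraicGeometry.VanGeemen1994

universe u

/-! ### A. Non-degeneracy of `Q_{h_K}` on `H¹(A(ℂ); ℂ)` and isotropy of the eigenspaces -/

section Nondegenerate

variable {m d : ℕ} {A : AbelianVariety ℂ}

/-- **`Q_{h_K}` is non-degenerate on `H¹(A(ℂ); ℂ)`** (`dim A = m + 1 ≥ 2`, `h_K = d·e^*a + φ^*e^*a`,
`a` rational non-zero): a class `x` with `Q_{h_K}(x, y) = 0` for all `y` vanishes. The kernel is stable
under complex conjugation (`h_K` is rational), so it contains the real classes `x + x̄` and `i(x - x̄)`,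
and a non-zero REAL class `r` has `Q_{h_K}(r, Cr) = t·ω₀ ≠ 0` by the positivity of the period point
(`exists_pos_polarizationPairingOne_weilOperatorOne`, the second Riemann condition). Van Geemen
Lemma 5.2 (2): "`H` is a non-degenerate Hermitian form". [cite: vanGeemen1994HodgeAV, Lemma 5.2 (2)]
[cite: LangeBirkenhake1992, Thm. 4.2.1] -/
theorem eq_zero_of_forall_polarizationPairingOne_ksymm_eq_zero (hm : 1 ≤ m) (hA : A.dim = m + 1)
    (hd : 0 < d) (φ : A ⟶ A) (e : ProjectiveEmbedding A.X) {a : complexBetti (projectiveSpace e.n ℂ) 2}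
    (ha : IsRationalClass a) (ha0 : a ≠ 0) {x : complexBetti A.X 1}
    (hx : ∀ y, polarizationPairingOne A.X
      ((d : ℂ) • complexBetti.map e.ι 2 a + complexBetti.map φ.hom.hom.hom 2 (complexBetti.map e.ι 2 a)) m
      x y = 0) : x = 0 := by
  set hK := (d : ℂ) • complexBetti.map e.ι 2 a + complexBetti.map φ.hom.hom.hom 2 (complexBetti.map e.ι 2 a)
    with hKdef
  set Q := polarizationPairingOne A.X hK m with hQdef
  by_contra hx0
  obtain ⟨ω₀, -, hω0, hpos⟩ := exists_pos_polarizationPairingOne_weilOperatorOne hm hA hd φ e ha ha0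
  have hKrat : IsRationalClass hK := isRationalClass_ksymm d φ e ha
  -- the conjugate class is in the kernel too
  have hx' : ∀ y, Q (conjClass (ComplexPoints A.X) 1 x) y = 0 := fun y ↦ by
    have h := conjClass_polarizationPairingOne hKrat m x (conjClass (ComplexPoints A.X) 1 y)
    rw [← hQdef, hx, conjClass_zero, conjClass_conjClass] at h
    exact h.symm
  -- contradiction from a non-zero real class in the kernel
  have key : ∀ r : complexBetti A.X 1, conjClass (ComplexPoints A.X) 1 r = r → r ≠ 0 →
      (∀ y, Q r y = 0) → False := by
    intro r hr hr0 hQr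
    obtain ⟨t, ht, hQt⟩ := hpos r hr hr0
    rw [← hKdef, ← hQdef, hQr] at hQt
    rcases smul_eq_zero.1 hQt.symm with h | h
    · exact absurd (by exact_mod_cast h : t = 0) ht.ne'
    · exact hω0 h
  by_cases hsum : x + conjClass (ComplexPoints A.X) 1 x = 0
  · -- `x̄ = -x`: the class `i • x` is real
    have hconj : conjClass (ComplexPoints A.X) 1 x = -x := eq_neg_of_add_eq_zero_right hsum
    refine key (Complex.I • x) ?_ (smul_ne_zero Complex.I_ne_zero hx0) fun y ↦ ?_
    · rw [conjClass_I_smul, hconj, smul_neg, neg_neg]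
    · rw [LinearMap.map_smul₂, hx, smul_zero]
  · refine key (x + conjClass (ComplexPoints A.X) 1 x) ?_ hsum fun y ↦ ?_
    · rw [conjClass_add, conjClass_conjClass, add_comm]
    · rw [LinearMap.map_add₂, hx, hx', add_zero]

/-- **The eigenspaces of `φ^*` are `Q_{h_K}`-isotropic**: if `φ^*x = εx`, `φ^*y = εy` with `ε² = -d`
then `Q_{h_K}(x, y) = 0` — from `Q_{h_K}(φ^*x, φ^*y) = d·Q_{h_K}(x, y)` (`K`-compatibility of the
polarization) and `d ≠ 0`: `-d·Q = d·Q`. Van Geemen 6.9–6.10 / proof of 6.12: `V_ℂ = W ⊕ W^*` with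
`W`, `W^*` dual to each other under `E`. [cite: vanGeemen1994HodgeAV, Lemma 5.2 (2), 6.9 and proof of Thm. 6.12] -/
theorem polarizationPairingOne_ksymm_eq_zero_of_mem_eigenspace (hA : A.dim = m + 1) (hd : 0 < d)
    {φ : A ⟶ A} (hφ : φ ≫ φ = -(d • 𝟙 A)) (e : ProjectiveEmbedding A.X)
    (a : complexBetti (projectiveSpace e.n ℂ) 2) {ε : ℂ} (hε : ε ^ 2 = -(d : ℂ))
    {x y : complexBetti A.X 1} (hx : x ∈ Module.End.eigenspace (pullbackOne A φ) ε)
    (hy : y ∈ Module.End.eigenspace (pullbackOne A φ) ε) :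
    polarizationPairingOne A.X
      ((d : ℂ) • complexBetti.map e.ι 2 a + complexBetti.map φ.hom.hom.hom 2 (complexBetti.map e.ι 2 a)) m
      x y = 0 := by
  rw [Module.End.mem_eigenspace_iff] at hx hy
  have h := polarizationPairingOne_map_map_ksymm hA hd hφ e a x y
  change polarizationPairingOne A.X _ m (pullbackOne A φ x) (pullbackOne A φ y) = _ at h
  rw [hx, hy, LinearMap.map_smul₂, map_smul, smul_smul, ← sq, hε] at h
  -- `-d • Q = d • Q`
  have h2 : ((2 : ℂ) * d) • polarizationPairingOne A.X
      ((d : ℂ) • complexBetti.map e.ι 2 a + complexBetti.map φ.hom.hom.hom 2 (complexBetti.map e.ι 2 a)) m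
      x y = 0 := by
    rw [mul_smul, two_smul]
    nth_rewrite 1 [← h]
    rw [neg_smul, neg_add_cancel]
  have hd0 : ((2 : ℂ) * d) ≠ 0 := mul_ne_zero two_ne_zero (Nat.cast_ne_zero.2 hd.ne')
  exact (smul_eq_zero.1 h2).resolve_left hd0

end Nondegenerate

/-! ### B. The top line, its coordinate, and the duality `W̄ ≃ (W)^*` -/

section Duality

variable {m d : ℕ} {A : AbelianVariety ℂ}

/-- A generator `ω_A` of the top line `H^{2m+2}(A(ℂ); ℂ) ≅ ℂ` (`dim A = m + 1`). [cite: LangeBirkenhake1992, Exercise 1.1.6 (8)] -/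
def topGen (hA : A.dim = m + 1) : complexBetti A.X (2 + 2 * m) :=
  Module.basisUnique Unit (finrank_complexBetti_two_add_two_mul_eq_one (isSmoothProjective_of_dim_eq' hA)) ()

/-- The coordinate `ℓ : H^{2m+2}(A(ℂ); ℂ) → ℂ` along `ω_A` ("`⋀²ⁿW ≅ ℂ`", van Geemen, proof of Thm. 6.12).
[cite: vanGeemen1994HodgeAV, proof of Thm. 6.12] -/
def topCoord (hA : A.dim = m + 1) : complexBetti A.X (2 + 2 * m) →ₗ[ℂ] ℂ :=
  (Module.basisUnique Unit (finrank_complexBetti_two_add_two_mul_eq_one (isSmoothProjective_of_dim_eq' hA))).coord ()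

/-- `v = ℓ(v) • ω_A` on the top line. [cite: LangeBirkenhake1992, Exercise 1.1.6 (8)] -/
theorem topCoord_smul_topGen (hA : A.dim = m + 1) (v : complexBetti A.X (2 + 2 * m)) :
    topCoord hA v • topGen hA = v := by
  set b := Module.basisUnique Unit (finrank_complexBetti_two_add_two_mul_eq_one (isSmoothProjective_of_dim_eq' hA))
  have h := b.sum_repr v
  rwa [Fintype.sum_unique] at h

/-- `ℓ(ω_A) = 1`. [folklore] -/
private theorem topCoord_topGen (hA : A.dim = m + 1) : topCoord hA (topGen hA) = 1 := by
  set b := Module.basisUnique Unit (finrank_complexBetti_two_add_two_mul_eq_one (isSmoothProjective_of_dim_eq' hA))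
  change b.coord () (b ()) = 1
  rw [Module.Basis.coord_apply, b.repr_self, Finsupp.single_eq_same]

/-- `ℓ` is injective (the top line is a line). [folklore] -/
private theorem topCoord_eq_zero_iff (hA : A.dim = m + 1) {v : complexBetti A.X (2 + 2 * m)} :
    topCoord hA v = 0 ↔ v = 0 :=
  Module.basisUnique_repr_eq_zero_iff

/-- `ω_A ≠ 0`. [folklore] -/
private theorem topGen_ne_zero (hA : A.dim = m + 1) : topGen hA ≠ 0 := fun h ↦ by
  have h1 := topCoord_topGen hA
  rw [h, map_zero] at h1
  exact zero_ne_one h1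

variable (m) in
/-- `W = ker(φ^* - i√d) ⊆ H¹(A(ℂ); ℂ)` (van Geemen 6.10: "`W`"). [cite: vanGeemen1994HodgeAV, Lemma 6.10] -/
abbrev eigW (A : AbelianVariety ℂ) (φ : A ⟶ A) (d : ℕ) : Submodule ℂ (complexBetti A.X 1) :=
  Module.End.eigenspace (pullbackOne A φ) (Complex.I * (Real.sqrt d : ℂ))

/-- `W̄ = ker(φ^* + i√d) ⊆ H¹(A(ℂ); ℂ)` (van Geemen 6.10: "`W̄`", identified with `W^*` in the proof of
Thm. 6.12). [cite: vanGeemen1994HodgeAV, Lemma 6.10 and proof of Thm. 6.12] -/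
abbrev eigWbar (A : AbelianVariety ℂ) (φ : A ⟶ A) (d : ℕ) : Submodule ℂ (complexBetti A.X 1) :=
  Module.End.eigenspace (pullbackOne A φ) (-(Complex.I * (Real.sqrt d : ℂ)))

/-- **The duality map `W̄ → W^*`, `y ↦ (x ↦ ℓ Q_{h_K}(x, y))`** (van Geemen, proof of Thm. 6.12:
"`V_ℂ = W ⊕ W^*`" — `W̄` is identified with the dual of `W` through the polarization).
[cite: vanGeemen1994HodgeAV, proof of Thm. 6.12 and 6.9] -/
def dualityMap (hA : A.dim = m + 1) (φ : A ⟶ A) (d : ℕ) (e : ProjectiveEmbedding A.X)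
    (a : complexBetti (projectiveSpace e.n ℂ) 2) :
    eigWbar A φ d →ₗ[ℂ] Module.Dual ℂ (eigW A φ d) :=
  (((polarizationPairingOne A.X
      ((d : ℂ) • complexBetti.map e.ι 2 a + complexBetti.map φ.hom.hom.hom 2 (complexBetti.map e.ι 2 a)) m
      ).domRestrict (eigW A φ d)).flip.domRestrict (eigWbar A φ d)).compr₂ (topCoord hA)

/-- `dualityMap y x = ℓ Q_{h_K}(x, y)`. [folklore] -/
@[simp]
private theorem dualityMap_apply (hA : A.dim = m + 1) (φ : A ⟶ A) (d : ℕ) (e : ProjectiveEmbedding A.X)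
    (a : complexBetti (projectiveSpace e.n ℂ) 2) (y : eigWbar A φ d) (x : eigW A φ d) :
    dualityMap hA φ d e a y x = topCoord hA (polarizationPairingOne A.X
      ((d : ℂ) • complexBetti.map e.ι 2 a + complexBetti.map φ.hom.hom.hom 2 (complexBetti.map e.ι 2 a)) m
      (x : complexBetti A.X 1) (y : complexBetti A.X 1)) := rfl

/-- **The duality map is injective** (`dim A = m + 1 ≥ 2`, `φ ≫ φ = -d`, `d ≥ 1`, `a` rational non-zero):
if `Q(x, y) = 0` for all `x ∈ W` then, `W̄` being isotropic and `H¹ = W ⊕ W̄`, `Q(·, y) = 0`, so `y = 0`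
by non-degeneracy. [cite: vanGeemen1994HodgeAV, Lemma 5.2 (2) and proof of Thm. 6.12] -/
theorem dualityMap_injective (hm : 1 ≤ m) (hA : A.dim = m + 1) (hd : 0 < d) {φ : A ⟶ A}
    (hφ : φ ≫ φ = -(d • 𝟙 A)) (e : ProjectiveEmbedding A.X) {a : complexBetti (projectiveSpace e.n ℂ) 2}
    (ha : IsRationalClass a) (ha0 : a ≠ 0) : Function.Injective (dualityMap hA φ d e a) := by
  set hK := (d : ℂ) • complexBetti.map e.ι 2 a + complexBetti.map φ.hom.hom.hom 2 (complexBetti.map e.ι 2 a)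
    with hKdef
  set Q := polarizationPairingOne A.X hK m with hQdef
  rw [← LinearMap.ker_eq_bot, Submodule.eq_bot_iff]
  intro y hy
  rw [LinearMap.mem_ker] at hy
  have hμ2 : (-(Complex.I * (Real.sqrt d : ℂ))) ^ 2 = -(d : ℂ) := by rw [neg_sq, I_mul_sqrt_sq]
  -- `Q(x, y) = 0` for `x ∈ W`
  have hW : ∀ x ∈ eigW A φ d, Q x y = 0 := fun x hx ↦ by
    have h := LinearMap.congr_fun hy ⟨x, hx⟩
    rw [dualityMap_apply, LinearMap.zero_apply, topCoord_eq_zero_iff] at h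
    exact h
  -- `Q(x', y) = 0` for `x' ∈ W̄` (isotropy)
  have hWbar : ∀ x ∈ eigWbar A φ d, Q x y = 0 := fun x hx ↦
    polarizationPairingOne_ksymm_eq_zero_of_mem_eigenspace hA hd hφ e a hμ2 hx y.2
  -- hence `Q(v, y) = 0` for all `v`, and `Q(y, v) = 0`
  have hall : ∀ v, Q (y : complexBetti A.X 1) v = 0 := fun v ↦ by
    have hv : v ∈ eigW A φ d ⊔ eigWbar A φ d := by
      rw [(isCompl_eigenspace_eigenspace_neg hd hφ).sup_eq_top]; exact Submodule.mem_top
    obtain ⟨x, hx, x', hx', rfl⟩ := Submodule.mem_sup.1 hv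
    rw [polarizationPairingOne_swap, map_add, LinearMap.add_apply, hW x hx, hWbar x' hx', add_zero, neg_zero]
  have h0 := eq_zero_of_forall_polarizationPairingOne_ksymm_eq_zero hm hA hd φ e ha ha0 hall
  exact Subtype.ext h0

/-- `dim W̄ = dim W^*`. [cite: vanGeemen1994HodgeAV, proof of Lemma 5.2 and of Thm. 6.12] -/
theorem finrank_eigWbar_eq_finrank_dual (hd : 0 < d) {φ : A ⟶ A} (hφ : φ ≫ φ = -(d • 𝟙 A)) :
    Module.finrank ℂ (eigWbar A φ d) = Module.finrank ℂ (Module.Dual ℂ (eigW A φ d)) := by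
  haveI := finite_complexBetti_abelianVariety A 1
  rw [Subspace.dual_finrank_eq]
  exact (finrank_eigenspace_eq_finrank_eigenspace_neg hd hφ).symm

/-- **`W̄ ≅ W^*` via the polarization** ("`V_ℂ := V ⊗_ℚ ℂ = W ⊕ W^*`", van Geemen, proof of Thm. 6.12).
[cite: vanGeemen1994HodgeAV, proof of Thm. 6.12] -/
def dualityEquiv (hm : 1 ≤ m) (hA : A.dim = m + 1) (hd : 0 < d) {φ : A ⟶ A}
    (hφ : φ ≫ φ = -(d • 𝟙 A)) (e : ProjectiveEmbedding A.X) {a : complexBetti (projectiveSpace e.n ℂ) 2}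
    (ha : IsRationalClass a) (ha0 : a ≠ 0) : eigWbar A φ d ≃ₗ[ℂ] Module.Dual ℂ (eigW A φ d) :=
  LinearEquiv.ofBijective (dualityMap hA φ d e a) (by
    haveI := finite_complexBetti_abelianVariety A 1
    refine ⟨dualityMap_injective hm hA hd hφ e ha ha0, ?_⟩
    exact (LinearMap.injective_iff_surjective_of_finrank_eq_finrank
      (finrank_eigWbar_eq_finrank_dual hd hφ)).1 (dualityMap_injective hm hA hd hφ e ha ha0))

/-- `dualityEquiv y x = ℓ Q_{h_K}(x, y)`. [folklore] -/
@[simp]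
private theorem dualityEquiv_apply (hm : 1 ≤ m) (hA : A.dim = m + 1) (hd : 0 < d) {φ : A ⟶ A}
    (hφ : φ ≫ φ = -(d • 𝟙 A)) (e : ProjectiveEmbedding A.X) {a : complexBetti (projectiveSpace e.n ℂ) 2}
    (ha : IsRationalClass a) (ha0 : a ≠ 0) (y : eigWbar A φ d) (x : eigW A φ d) :
    dualityEquiv hm hA hd hφ e ha ha0 y x = topCoord hA (polarizationPairingOne A.X
      ((d : ℂ) • complexBetti.map e.ι 2 a + complexBetti.map φ.hom.hom.hom 2 (complexBetti.map e.ι 2 a)) m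
      (x : complexBetti A.X 1) (y : complexBetti A.X 1)) := rfl

/-- **Dual bases**: for a basis `w` of `W`, the basis `w^*` of `W̄` with `ℓ Q_{h_K}(wᵢ, w^*ⱼ) = δᵢⱼ`
(van Geemen, proof of Thm. 6.12: `W^*` "its dual"). [cite: vanGeemen1994HodgeAV, proof of Thm. 6.12] -/
def dualBasisWbar {ι : Type*} [Fintype ι] [DecidableEq ι] (hm : 1 ≤ m) (hA : A.dim = m + 1) (hd : 0 < d)
    {φ : A ⟶ A} (hφ : φ ≫ φ = -(d • 𝟙 A)) (e : ProjectiveEmbedding A.X)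
    {a : complexBetti (projectiveSpace e.n ℂ) 2} (ha : IsRationalClass a) (ha0 : a ≠ 0)
    (w : Module.Basis ι ℂ (eigW A φ d)) : Module.Basis ι ℂ (eigWbar A φ d) :=
  w.dualBasis.map (dualityEquiv hm hA hd hφ e ha ha0).symm

/-- `ℓ Q_{h_K}(wᵢ, w^*ⱼ) = δᵢⱼ`. [cite: vanGeemen1994HodgeAV, proof of Thm. 6.12] -/
theorem topCoord_polarizationPairingOne_dualBasisWbar {ι : Type*} [Fintype ι] [DecidableEq ι] (hm : 1 ≤ m)
    (hA : A.dim = m + 1) (hd : 0 < d) {φ : A ⟶ A} (hφ : φ ≫ φ = -(d • 𝟙 A)) (e : ProjectiveEmbedding A.X)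
    {a : complexBetti (projectiveSpace e.n ℂ) 2} (ha : IsRationalClass a) (ha0 : a ≠ 0)
    (w : Module.Basis ι ℂ (eigW A φ d)) (i j : ι) :
    topCoord hA (polarizationPairingOne A.X
      ((d : ℂ) • complexBetti.map e.ι 2 a + complexBetti.map φ.hom.hom.hom 2 (complexBetti.map e.ι 2 a)) m
      (w i : complexBetti A.X 1) (dualBasisWbar hm hA hd hφ e ha ha0 w j : complexBetti A.X 1)) =
      if i = j then 1 else 0 := by
  rw [← dualityEquiv_apply hm hA hd hφ e ha ha0, dualBasisWbar, Module.Basis.map_apply,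
    LinearEquiv.apply_symm_apply, Module.Basis.dualBasis_apply_self]

/-- `Q_{h_K}(wᵢ, w^*ⱼ) = δᵢⱼ • ω_A`. [cite: vanGeemen1994HodgeAV, proof of Thm. 6.12] -/
theorem polarizationPairingOne_dualBasisWbar {ι : Type*} [Fintype ι] [DecidableEq ι] (hm : 1 ≤ m)
    (hA : A.dim = m + 1) (hd : 0 < d) {φ : A ⟶ A} (hφ : φ ≫ φ = -(d • 𝟙 A)) (e : ProjectiveEmbedding A.X)
    {a : complexBetti (projectiveSpace e.n ℂ) 2} (ha : IsRationalClass a) (ha0 : a ≠ 0)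
    (w : Module.Basis ι ℂ (eigW A φ d)) (i j : ι) :
    polarizationPairingOne A.X
      ((d : ℂ) • complexBetti.map e.ι 2 a + complexBetti.map φ.hom.hom.hom 2 (complexBetti.map e.ι 2 a)) m
      (w i : complexBetti A.X 1) (dualBasisWbar hm hA hd hφ e ha ha0 w j : complexBetti A.X 1) =
      (if i = j then (1 : ℂ) else 0) • topGen hA := by
  rw [← topCoord_polarizationPairingOne_dualBasisWbar hm hA hd hφ e ha ha0 w i j, topCoord_smul_topGen]

end Duality

/-! ### C. Monomial automorphisms: determinant, the Weil basis, and elements of `SU_H(ℂ)` -/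

section MonomialDet

variable {R M : Type*} [CommRing R] [AddCommGroup M] [Module R M] {k : ℕ}

/-- **Determinant of a monomial endomorphism**: if `f (bᵢ) = cᵢ • b_{σ i}` in a basis `b` then
`det f = sign σ · ∏ cᵢ` (row permutation of a diagonal matrix). [folklore] -/
private theorem det_eq_sign_mul_prod_of_apply_basis (b : Module.Basis (Fin k) R M) (f : M →ₗ[R] M)
    (σ : Equiv.Perm (Fin k)) (c : Fin k → R) (hf : ∀ i, f (b i) = c i • b (σ i)) :
    LinearMap.det f = (Equiv.Perm.sign σ : R) * ∏ i, c i := by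
  classical
  rw [← LinearMap.det_toMatrix b]
  have hM : LinearMap.toMatrix b b f = (Matrix.diagonal c).submatrix σ.symm id := by
    ext a i
    rw [LinearMap.toMatrix_apply, hf, map_smul, b.repr_self, Finsupp.smul_apply, smul_eq_mul,
      Matrix.submatrix_apply, Matrix.diagonal_apply, id, Finsupp.single_apply]
    by_cases h : σ i = a
    · subst h
      simp
    · have h2 : ¬σ.symm a = i := fun h' => h (by rw [← h', Equiv.apply_symm_apply])
      rw [if_neg h, if_neg h2, mul_zero]
  rw [hM, Matrix.det_permute, Matrix.det_diagonal, Equiv.Perm.sign_symm]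

end MonomialDet

section WeilBasis

variable {m d : ℕ} {A : AbelianVariety ℂ} {k : ℕ}

/-- **The Weil basis of `H¹(A(ℂ); ℂ) = W ⊕ W̄`**: a basis `w` of `W` followed by its dual basis `w^*`
of `W̄` (`castAdd i ↦ wᵢ`, `natAdd j ↦ w^*ⱼ`). [cite: vanGeemen1994HodgeAV, proof of Thm. 6.12 ("`V_ℂ = W ⊕ W^*`")] -/
def weilBasis (hm : 1 ≤ m) (hA : A.dim = m + 1) (hd : 0 < d) {φ : A ⟶ A} (hφ : φ ≫ φ = -(d • 𝟙 A))
    (e : ProjectiveEmbedding A.X) {a : complexBetti (projectiveSpace e.n ℂ) 2} (ha : IsRationalClass a)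
    (ha0 : a ≠ 0) (w : Module.Basis (Fin k) ℂ (eigW A φ d)) :
    Module.Basis (Fin (k + k)) ℂ (complexBetti A.X 1) :=
  (((w.prod (dualBasisWbar hm hA hd hφ e ha ha0 w)).map
    (Submodule.prodEquivOfIsCompl _ _ (isCompl_eigenspace_eigenspace_neg hd hφ))).reindex finSumFinEquiv)

variable (hm : 1 ≤ m) (hA : A.dim = m + 1) (hd : 0 < d) {φ : A ⟶ A} (hφ : φ ≫ φ = -(d • 𝟙 A))
  (e : ProjectiveEmbedding A.X) {a : complexBetti (projectiveSpace e.n ℂ) 2} (ha : IsRationalClass a)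
  (ha0 : a ≠ 0) (w : Module.Basis (Fin k) ℂ (eigW A φ d))

/-- The first block of the Weil basis is `w`. [cite: vanGeemen1994HodgeAV, proof of Thm. 6.12] -/
@[simp]
theorem weilBasis_castAdd (i : Fin k) :
    weilBasis hm hA hd hφ e ha ha0 w (Fin.castAdd k i) = (w i : complexBetti A.X 1) := by
  rw [weilBasis, Module.Basis.reindex_apply, finSumFinEquiv_symm_apply_castAdd, Module.Basis.map_apply,
    Module.Basis.prod_apply, Sum.elim_inl, Function.comp_apply, LinearMap.inl_apply,
    Submodule.coe_prodEquivOfIsCompl', Submodule.coe_zero, add_zero]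

/-- The second block of the Weil basis is the dual basis `w^*`. [cite: vanGeemen1994HodgeAV, proof of Thm. 6.12] -/
@[simp]
theorem weilBasis_natAdd (j : Fin k) :
    weilBasis hm hA hd hφ e ha ha0 w (Fin.natAdd k j) =
      (dualBasisWbar hm hA hd hφ e ha ha0 w j : complexBetti A.X 1) := by
  rw [weilBasis, Module.Basis.reindex_apply, finSumFinEquiv_symm_apply_natAdd, Module.Basis.map_apply,
    Module.Basis.prod_apply, Sum.elim_inr, Function.comp_apply, LinearMap.inr_apply,
    Submodule.coe_prodEquivOfIsCompl', Submodule.coe_zero, zero_add]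

/-- `φ^*` is diagonal in the Weil basis: eigenvalue `i√d` on the first block. [cite: vanGeemen1994HodgeAV, Lemma 6.10] -/
theorem pullbackOne_weilBasis_castAdd (i : Fin k) :
    pullbackOne A φ (weilBasis hm hA hd hφ e ha ha0 w (Fin.castAdd k i)) =
      (Complex.I * (Real.sqrt d : ℂ)) • weilBasis hm hA hd hφ e ha ha0 w (Fin.castAdd k i) := by
  rw [weilBasis_castAdd]
  exact Module.End.mem_eigenspace_iff.1 (w i).2

/-- `φ^*` is diagonal in the Weil basis: eigenvalue `-i√d` on the second block. [cite: vanGeemen1994HodgeAV, Lemma 6.10] -/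
theorem pullbackOne_weilBasis_natAdd (j : Fin k) :
    pullbackOne A φ (weilBasis hm hA hd hφ e ha ha0 w (Fin.natAdd k j)) =
      (-(Complex.I * (Real.sqrt d : ℂ))) • weilBasis hm hA hd hφ e ha ha0 w (Fin.natAdd k j) := by
  rw [weilBasis_natAdd]
  exact Module.End.mem_eigenspace_iff.1 (dualBasisWbar hm hA hd hφ e ha ha0 w j).2

/-- The Gram values of `Q_{h_K}` in the Weil basis, first × first block: `0`. [cite: vanGeemen1994HodgeAV, proof of Thm. 6.12] -/
theorem polarizationPairingOne_weilBasis_castAdd_castAdd (i i' : Fin k) :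
    polarizationPairingOne A.X
      ((d : ℂ) • complexBetti.map e.ι 2 a + complexBetti.map φ.hom.hom.hom 2 (complexBetti.map e.ι 2 a)) m
      (weilBasis hm hA hd hφ e ha ha0 w (Fin.castAdd k i)) (weilBasis hm hA hd hφ e ha ha0 w (Fin.castAdd k i')) = 0 := by
  rw [weilBasis_castAdd, weilBasis_castAdd]
  exact polarizationPairingOne_ksymm_eq_zero_of_mem_eigenspace hA hd hφ e a (I_mul_sqrt_sq d) (w i).2 (w i').2

/-- Second × second block: `0`. [cite: vanGeemen1994HodgeAV, proof of Thm. 6.12] -/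
theorem polarizationPairingOne_weilBasis_natAdd_natAdd (j j' : Fin k) :
    polarizationPairingOne A.X
      ((d : ℂ) • complexBetti.map e.ι 2 a + complexBetti.map φ.hom.hom.hom 2 (complexBetti.map e.ι 2 a)) m
      (weilBasis hm hA hd hφ e ha ha0 w (Fin.natAdd k j)) (weilBasis hm hA hd hφ e ha ha0 w (Fin.natAdd k j')) = 0 := by
  rw [weilBasis_natAdd, weilBasis_natAdd]
  have hμ2 : (-(Complex.I * (Real.sqrt d : ℂ))) ^ 2 = -(d : ℂ) := by rw [neg_sq, I_mul_sqrt_sq]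
  exact polarizationPairingOne_ksymm_eq_zero_of_mem_eigenspace hA hd hφ e a hμ2
    (dualBasisWbar hm hA hd hφ e ha ha0 w j).2 (dualBasisWbar hm hA hd hφ e ha ha0 w j').2

/-- First × second block: `δᵢⱼ ω_A`. [cite: vanGeemen1994HodgeAV, proof of Thm. 6.12] -/
theorem polarizationPairingOne_weilBasis_castAdd_natAdd (i j : Fin k) :
    polarizationPairingOne A.X
      ((d : ℂ) • complexBetti.map e.ι 2 a + complexBetti.map φ.hom.hom.hom 2 (complexBetti.map e.ι 2 a)) m
      (weilBasis hm hA hd hφ e ha ha0 w (Fin.castAdd k i)) (weilBasis hm hA hd hφ e ha ha0 w (Fin.natAdd k j)) =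
      (if i = j then (1 : ℂ) else 0) • topGen hA := by
  rw [weilBasis_castAdd, weilBasis_natAdd]
  exact polarizationPairingOne_dualBasisWbar hm hA hd hφ e ha ha0 w i j

/-- Second × first block: `-δᵢⱼ ω_A`. [cite: vanGeemen1994HodgeAV, proof of Thm. 6.12] -/
theorem polarizationPairingOne_weilBasis_natAdd_castAdd (j i : Fin k) :
    polarizationPairingOne A.X
      ((d : ℂ) • complexBetti.map e.ι 2 a + complexBetti.map φ.hom.hom.hom 2 (complexBetti.map e.ι 2 a)) m
      (weilBasis hm hA hd hφ e ha ha0 w (Fin.natAdd k j)) (weilBasis hm hA hd hφ e ha ha0 w (Fin.castAdd k i)) =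
      -((if i = j then (1 : ℂ) else 0) • topGen hA) := by
  rw [polarizationPairingOne_swap, polarizationPairingOne_weilBasis_castAdd_natAdd]

/-- The block permutation `σ ⊕ σ` of `Fin (k + k)`. [cite: vanGeemen1994HodgeAV, proof of Thm. 6.12] -/
def blockPerm (σ : Equiv.Perm (Fin k)) : Equiv.Perm (Fin (k + k)) :=
  finSumFinEquiv.permCongr (σ.sumCongr σ)

/-- Auxiliary (blockPerm castAdd). [folklore] -/
@[simp]
private theorem blockPerm_castAdd (σ : Equiv.Perm (Fin k)) (i : Fin k) :
    blockPerm σ (Fin.castAdd k i) = Fin.castAdd k (σ i) := by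
  rw [blockPerm, Equiv.permCongr_apply, finSumFinEquiv_symm_apply_castAdd, Equiv.sumCongr_apply, Sum.map_inl,
    finSumFinEquiv_apply_left]

/-- Auxiliary (blockPerm natAdd). [folklore] -/
@[simp]
private theorem blockPerm_natAdd (σ : Equiv.Perm (Fin k)) (j : Fin k) :
    blockPerm σ (Fin.natAdd k j) = Fin.natAdd k (σ j) := by
  rw [blockPerm, Equiv.permCongr_apply, finSumFinEquiv_symm_apply_natAdd, Equiv.sumCongr_apply, Sum.map_inr,
    finSumFinEquiv_apply_right]

/-- **The monomial automorphism** of `H¹(A(ℂ); ℂ)` attached to a permutation `σ` of the index set and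
units `c`: `wᵢ ↦ c_{σi} w_{σ i}`, `w^*ⱼ ↦ c'_{σ j} w^*_{σ j}` (`c` on the first block, `c'` on the second).
These are the diagonal tori and signed transpositions of `SL(W) ≅ SU_H(ℂ)` used in the proof of
Thm. 6.12. [cite: vanGeemen1994HodgeAV, Lemma 6.10 and proof of Thm. 6.12] -/
def monoAuto (σ : Equiv.Perm (Fin k)) (c : Fin (k + k) → ℂˣ) :
    complexBetti A.X 1 ≃ₗ[ℂ] complexBetti A.X 1 :=
  (weilBasis hm hA hd hφ e ha ha0 w).equiv ((weilBasis hm hA hd hφ e ha ha0 w).unitsSMul c) (blockPerm σ)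

/-- `monoAuto` on the Weil basis: `b_p ↦ c_{π p} • b_{π p}`, `π = σ ⊕ σ`. [cite: vanGeemen1994HodgeAV, proof of Thm. 6.12] -/
theorem monoAuto_weilBasis (σ : Equiv.Perm (Fin k)) (c : Fin (k + k) → ℂˣ) (p : Fin (k + k)) :
    monoAuto hm hA hd hφ e ha ha0 w σ c (weilBasis hm hA hd hφ e ha ha0 w p) =
      (c (blockPerm σ p) : ℂ) • weilBasis hm hA hd hφ e ha ha0 w (blockPerm σ p) := by
  rw [monoAuto, Module.Basis.equiv_apply, Module.Basis.unitsSMul_apply, Units.smul_def]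

/-- `monoAuto` commutes with `φ^*` (it preserves the two eigenspaces). [cite: vanGeemen1994HodgeAV, Lemma 6.10] -/
theorem monoAuto_comm (σ : Equiv.Perm (Fin k)) (c : Fin (k + k) → ℂˣ) (x : complexBetti A.X 1) :
    monoAuto hm hA hd hφ e ha ha0 w σ c (pullbackOne A φ x) =
      pullbackOne A φ (monoAuto hm hA hd hφ e ha ha0 w σ c x) := by
  set u := monoAuto hm hA hd hφ e ha ha0 w σ c with hu
  set b := weilBasis hm hA hd hφ e ha ha0 w with hb
  suffices h : (u : complexBetti A.X 1 →ₗ[ℂ] complexBetti A.X 1) ∘ₗ pullbackOne A φ =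
      pullbackOne A φ ∘ₗ (u : complexBetti A.X 1 →ₗ[ℂ] complexBetti A.X 1) from
    LinearMap.congr_fun h x
  refine b.ext fun p ↦ ?_
  simp only [LinearMap.coe_comp, Function.comp_apply, LinearEquiv.coe_coe]
  refine Fin.addCases (fun i ↦ ?_) (fun j ↦ ?_) p
  · rw [hb, pullbackOne_weilBasis_castAdd, map_smul, hu, monoAuto_weilBasis, blockPerm_castAdd, map_smul,
      pullbackOne_weilBasis_castAdd, smul_comm]
  · rw [hb, pullbackOne_weilBasis_natAdd, map_smul, hu, monoAuto_weilBasis, blockPerm_natAdd, map_smul,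
      pullbackOne_weilBasis_natAdd, smul_comm]

/-- `monoAuto` preserves `Q_{h_K}` when `c_{castAdd i} · c_{natAdd i} = 1` for all `i` (the units on
`w^*` are the inverses of those on `w`). [cite: vanGeemen1994HodgeAV, 6.9 and proof of Thm. 6.12] -/
theorem polarizationPairingOne_monoAuto (σ : Equiv.Perm (Fin k)) (c : Fin (k + k) → ℂˣ)
    (hc : ∀ i, (c (Fin.castAdd k i) : ℂ) * c (Fin.natAdd k i) = 1) (x y : complexBetti A.X 1) :
    polarizationPairingOne A.X
      ((d : ℂ) • complexBetti.map e.ι 2 a + complexBetti.map φ.hom.hom.hom 2 (complexBetti.map e.ι 2 a)) m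
      (monoAuto hm hA hd hφ e ha ha0 w σ c x) (monoAuto hm hA hd hφ e ha ha0 w σ c y) =
    polarizationPairingOne A.X
      ((d : ℂ) • complexBetti.map e.ι 2 a + complexBetti.map φ.hom.hom.hom 2 (complexBetti.map e.ι 2 a)) m
      x y := by
  set u := monoAuto hm hA hd hφ e ha ha0 w σ c with hu
  set b := weilBasis hm hA hd hφ e ha ha0 w with hb
  set Q := polarizationPairingOne A.X
      ((d : ℂ) • complexBetti.map e.ι 2 a + complexBetti.map φ.hom.hom.hom 2 (complexBetti.map e.ι 2 a)) m
    with hQ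
  suffices h : Q.compl₁₂ (u : complexBetti A.X 1 →ₗ[ℂ] complexBetti A.X 1)
      (u : complexBetti A.X 1 →ₗ[ℂ] complexBetti A.X 1) = Q from
    LinearMap.congr_fun₂ h x y
  refine b.ext fun p ↦ b.ext fun q ↦ ?_
  rw [LinearMap.compl₁₂_apply, LinearEquiv.coe_coe, hb, hu, monoAuto_weilBasis, monoAuto_weilBasis,
    LinearMap.map_smul₂, map_smul]
  refine Fin.addCases (fun i ↦ ?_) (fun j ↦ ?_) p <;> refine Fin.addCases (fun i' ↦ ?_) (fun j' ↦ ?_) q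
  · rw [blockPerm_castAdd, blockPerm_castAdd, hQ, polarizationPairingOne_weilBasis_castAdd_castAdd,
      polarizationPairingOne_weilBasis_castAdd_castAdd, smul_zero, smul_zero]
  · rw [blockPerm_castAdd, blockPerm_natAdd, hQ, polarizationPairingOne_weilBasis_castAdd_natAdd,
      polarizationPairingOne_weilBasis_castAdd_natAdd, smul_smul, smul_smul]
    by_cases h : i = j'
    · subst h
      rw [if_pos rfl, if_pos rfl, hc, one_mul]
    · rw [if_neg h, if_neg (fun h' => h (σ.injective h')), zero_smul, mul_zero, zero_smul]
  · rw [blockPerm_natAdd, blockPerm_castAdd, hQ, polarizationPairingOne_weilBasis_natAdd_castAdd,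
      polarizationPairingOne_weilBasis_natAdd_castAdd, smul_neg, smul_neg, smul_smul, smul_smul]
    by_cases h : i' = j
    · subst h
      have hc' : (c (Fin.natAdd k (σ i')) : ℂ) * c (Fin.castAdd k (σ i')) = 1 := by
        have h1 := hc (σ i'); rwa [mul_comm] at h1
      rw [if_pos rfl, if_pos rfl, hc', one_mul]
    · rw [if_neg h, if_neg (fun h' => h (σ.injective h')), zero_smul, mul_zero, zero_smul]
  · rw [blockPerm_natAdd, blockPerm_natAdd, hQ, polarizationPairingOne_weilBasis_natAdd_natAdd,
      polarizationPairingOne_weilBasis_natAdd_natAdd, smul_zero, smul_zero]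

/-- `det(monoAuto | W) = sign σ · ∏ᵢ c_{castAdd i}`. [cite: vanGeemen1994HodgeAV, Lemma 6.10] -/
theorem detOnEigenspace_monoAuto_pos (σ : Equiv.Perm (Fin k)) (c : Fin (k + k) → ℂˣ) :
    detOnEigenspace (monoAuto hm hA hd hφ e ha ha0 w σ c) (pullbackOne A φ)
      (monoAuto_comm hm hA hd hφ e ha ha0 w σ c) (Complex.I * (Real.sqrt d : ℂ)) =
      (Equiv.Perm.sign σ : ℂ) * ∏ i, (c (Fin.castAdd k i) : ℂ) := by
  unfold detOnEigenspace
  rw [det_eq_sign_mul_prod_of_apply_basis w _ σ (fun i => (c (Fin.castAdd k (σ i)) : ℂ))]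
  · congr 1
    exact Fintype.prod_equiv σ _ _ fun _ => rfl
  · intro i
    apply Subtype.ext
    rw [LinearMap.coe_restrict_apply, Submodule.coe_smul, LinearEquiv.coe_coe]
    rw [← weilBasis_castAdd hm hA hd hφ e ha ha0 w i, monoAuto_weilBasis, blockPerm_castAdd, weilBasis_castAdd]

/-- `det(monoAuto | W̄) = sign σ · ∏ⱼ c_{natAdd j}`. [cite: vanGeemen1994HodgeAV, Lemma 6.10] -/
theorem detOnEigenspace_monoAuto_neg (σ : Equiv.Perm (Fin k)) (c : Fin (k + k) → ℂˣ) :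
    detOnEigenspace (monoAuto hm hA hd hφ e ha ha0 w σ c) (pullbackOne A φ)
      (monoAuto_comm hm hA hd hφ e ha ha0 w σ c) (-(Complex.I * (Real.sqrt d : ℂ))) =
      (Equiv.Perm.sign σ : ℂ) * ∏ j, (c (Fin.natAdd k j) : ℂ) := by
  unfold detOnEigenspace
  rw [det_eq_sign_mul_prod_of_apply_basis (dualBasisWbar hm hA hd hφ e ha ha0 w) _ σ
    (fun j => (c (Fin.natAdd k (σ j)) : ℂ))]
  · congr 1
    exact Fintype.prod_equiv σ _ _ fun _ => rfl
  · intro j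
    apply Subtype.ext
    rw [LinearMap.coe_restrict_apply, Submodule.coe_smul, LinearEquiv.coe_coe]
    rw [← weilBasis_natAdd hm hA hd hφ e ha ha0 w j, monoAuto_weilBasis, blockPerm_natAdd, weilBasis_natAdd]

/-- **Monomial elements of `SU_H(ℂ)`**: if `c_{castAdd i} c_{natAdd i} = 1` for all `i` and
`sign σ · ∏ᵢ c_{castAdd i} = 1`, then `monoAuto σ c ∈ SU_H(ℂ)` — it commutes with `φ^*`, preserves
`Q_{h_K}`, and has determinant `1` on `W` and on `W̄` (there `sign σ · ∏ c_{natAdd i} =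
sign σ · (∏ c_{castAdd i})⁻¹ = (sign σ)² = 1`). Instances: the diagonal torus of `SL(W)` acting
contragrediently on `W̄ ≅ W^*`, and the signed transpositions. [cite: vanGeemen1994HodgeAV, Lemma 6.10 and proof of Thm. 6.12] -/
theorem monoAuto_mem_weilSpecialUnitaryGroup (n' d' : ℕ) (hn' : 2 * n' - 1 = m) (hd' : d' = d)
    (σ : Equiv.Perm (Fin k)) (c : Fin (k + k) → ℂˣ)
    (hc : ∀ i, (c (Fin.castAdd k i) : ℂ) * c (Fin.natAdd k i) = 1)
    (hdet : (Equiv.Perm.sign σ : ℂ) * ∏ i, (c (Fin.castAdd k i) : ℂ) = 1) :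
    monoAuto hm hA hd hφ e ha ha0 w σ c ∈ weilSpecialUnitaryGroup A φ n' d'
      ((d : ℂ) • complexBetti.map e.ι 2 a + complexBetti.map φ.hom.hom.hom 2 (complexBetti.map e.ι 2 a)) := by
  subst hn' hd'
  refine ⟨monoAuto_comm hm hA hd hφ e ha ha0 w σ c, polarizationPairingOne_monoAuto hm hA hd hφ e ha ha0 w σ c hc,
    ?_, ?_⟩
  · rw [detOnEigenspace_monoAuto_pos, hdet]
  · rw [detOnEigenspace_monoAuto_neg]
    have hprod : ∏ j, (c (Fin.natAdd k j) : ℂ) = (∏ i, (c (Fin.castAdd k i) : ℂ))⁻¹ := by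
      rw [← Finset.prod_inv_distrib]
      refine Finset.prod_congr rfl fun i _ ↦ eq_inv_of_mul_eq_one_left ?_
      have h1 := hc i
      rwa [mul_comm] at h1
    have hsign : ((Equiv.Perm.sign σ : ℤ) : ℂ) * ((Equiv.Perm.sign σ : ℤ) : ℂ) = 1 := by
      rw [← Int.cast_mul, ← Units.val_mul, Int.units_mul_self, Units.val_one, Int.cast_one]
    have hp : ∏ i, (c (Fin.castAdd k i) : ℂ) = ((Equiv.Perm.sign σ : ℤ) : ℂ)⁻¹ :=
      eq_inv_of_mul_eq_one_right hdet
    rw [hprod, hp, inv_inv, hsign]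

end WeilBasis

/-! ### D. The monomial basis of `H^q(A(ℂ); ℂ) = ⋀^q H¹` and the exterior action of monomial automorphisms -/

section Monomials

variable {A : AbelianVariety ℂ} {N : ℕ}

/-- `H•(A(ℂ); ℂ) = ⋀• H¹(A(ℂ); ℂ)` (the tree's theorem). [cite: LangeBirkenhake1992, Lemma 1.1.17 and Exercise 1.1.6 (7)] -/
theorem hasExteriorCohomologyH1 (A : AbelianVariety ℂ) : HasExteriorCohomologyH1 ℂ (ComplexPoints A.X) :=
  abelianVarietyCohomologyExteriorH1_holds.hasExteriorCohomologyH1 A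

/-- **The monomial basis of `H^q(A(ℂ); ℂ)`** attached to an ordered basis `b` of `H¹(A(ℂ); ℂ)`: the
products `b_{j₁} ∪ ⋯ ∪ b_{j_q}`, `j₁ < ⋯ < j_q` (Mathlib's basis of the exterior power transported along
`⋀^q H¹ ≅ H^q`). [cite: LangeBirkenhake1992, Lemma 1.1.17 and Exercise 1.1.6 (7)-(8)] -/
def monB (b : Module.Basis (Fin N) ℂ (complexBetti A.X 1)) (q : ℕ) :
    Module.Basis (Set.powersetCard (Fin N) q) ℂ (complexBetti A.X q) :=
  (b.exteriorPower q).map ((hasExteriorCohomologyH1 A).equiv q)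

/-- The monomial basis vector of `s = {j₁ < ⋯ < j_q}` is `b_{j₁} ∪ ⋯ ∪ b_{j_q}`. [cite: vanGeemen1994HodgeAV, proof of Thm. 6.12] -/
theorem monB_apply (b : Module.Basis (Fin N) ℂ (complexBetti A.X 1)) (q : ℕ) (s : Set.powersetCard (Fin N) q) :
    monB b q s = cupPowOne ℂ (ComplexPoints A.X) q (fun r => b (Finset.orderEmbOfFin s.val s.prop r)) := by
  rw [monB, Module.Basis.map_apply, exteriorPower.basis_apply, exteriorPower.ιMulti_family,
    HasExteriorCohomologyH1.equiv_apply, wedgeToCup_ιMulti]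
  rfl

/-- **The exterior action `⋀^q u` on `H^q(A(ℂ); ℂ)`** of a linear map `u` of `H¹(A(ℂ); ℂ)` (the tree's
`exteriorPullback`; van Geemen 6.5: "`G` acts on `∧ᵏV`"). [cite: vanGeemen1994HodgeAV, 6.5 and 4.8] -/
abbrev extAct (u : complexBetti A.X 1 →ₗ[ℂ] complexBetti A.X 1) (q : ℕ) :
    complexBetti A.X q →ₗ[ℂ] complexBetti A.X q :=
  exteriorPullback (hasExteriorCohomologyH1 A) u q

/-- `⋀^q u (v₁ ∪ ⋯ ∪ v_q) = u v₁ ∪ ⋯ ∪ u v_q`. [cite: vanGeemen1994HodgeAV, 6.5] -/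
theorem extAct_cupPowOne (u : complexBetti A.X 1 →ₗ[ℂ] complexBetti A.X 1) (q : ℕ)
    (v : Fin q → complexBetti A.X 1) :
    extAct u q (cupPowOne ℂ (ComplexPoints A.X) q v) = cupPowOne ℂ (ComplexPoints A.X) q (fun i => u (v i)) :=
  exteriorPullback_cupPowOne _ u q v

/-- **A Hodge-group element acts on `H^q` by the exterior action of its degree-one component**:
`g_q = ⋀^q g₁` (`hodgeGroup_apply_cupPowOne`; both sides agree on the spanning monomials).
[cite: vanGeemen1994HodgeAV, 6.5] -/
theorem hodgeGroup_apply_eq_extAct {g : ∀ k, complexBetti A.X k ≃ₗ[ℂ] complexBetti A.X k}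
    (hg : g ∈ hodgeGroup A.dim A.X) (q : ℕ) (x : complexBetti A.X q) :
    g q x = extAct (g 1 : complexBetti A.X 1 →ₗ[ℂ] complexBetti A.X 1) q x := by
  suffices h : (g q : complexBetti A.X q →ₗ[ℂ] complexBetti A.X q) =
      extAct (g 1 : complexBetti A.X 1 →ₗ[ℂ] complexBetti A.X 1) q from LinearMap.congr_fun h x
  refine exteriorPullback_ext (hasExteriorCohomologyH1 A) fun v ↦ ?_
  rw [LinearEquiv.coe_coe, hodgeGroup_apply_cupPowOne hg, extAct_cupPowOne]
  rfl

/-- **`Bᵖ ⊗ ℂ` is fixed by `⋀^{2p} u` for every `u ∈ SU_H(ℂ)` when `Hg = SU_H`** (van Geemen 6.6–6.7: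
`Bᵖ ⊗ ℂ = (H^{2p} ⊗ ℂ)^{G(ℂ)}`, the inclusion `⊆`). [cite: vanGeemen1994HodgeAV, Thm. 6.6, 6.7 and Thm. 6.12] -/
theorem extAct_eq_self_of_mem_hodgeClassSpan {φ : A ⟶ A} {n d : ℕ} {h : complexBetti A.X 2}
    (hSU : HasHodgeGroupSU A φ n d h) {u : complexBetti A.X 1 ≃ₗ[ℂ] complexBetti A.X 1}
    (hu : u ∈ weilSpecialUnitaryGroup A φ n d h) {p : ℕ} {x : complexBetti A.X (2 * p)}
    (hx : x ∈ hodgeClassSpan A.dim A.X p) :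
    extAct (u : complexBetti A.X 1 →ₗ[ℂ] complexBetti A.X 1) (2 * p) x = x := by
  have hu' : u ∈ hodgeGroupOne A.dim A.X := by rw [hSU]; exact hu
  obtain ⟨g, hg, rfl⟩ := mem_hodgeGroupOne_iff.1 hu'
  rw [← hodgeGroup_apply_eq_extAct hg]
  exact apply_eq_self_of_mem_hodgeClassSpan hg hx

/-- Image of an index set under a permutation (same cardinality). [cite: vanGeemen1994HodgeAV, proof of Thm. 6.12] -/
def permSet (π : Equiv.Perm (Fin N)) {q : ℕ} (s : Set.powersetCard (Fin N) q) : Set.powersetCard (Fin N) q :=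
  Set.powersetCard.ofCard (s := s.val.map π.toEmbedding) (by rw [Finset.card_map]; exact s.prop)

/-- Auxiliary (mem permSet). [folklore] -/
@[simp]
private theorem mem_permSet (π : Equiv.Perm (Fin N)) {q : ℕ} (s : Set.powersetCard (Fin N) q) (j : Fin N) :
    j ∈ (permSet π s).val ↔ π.symm j ∈ s.val := by
  change j ∈ s.val.map π.toEmbedding ↔ _
  rw [Finset.mem_map_equiv]

/-- Auxiliary (permSet symm permSet). [folklore] -/
private theorem permSet_symm_permSet (π : Equiv.Perm (Fin N)) {q : ℕ} (s : Set.powersetCard (Fin N) q) :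
    permSet π.symm (permSet π s) = s := by
  apply Subtype.ext
  ext j
  rw [mem_permSet, mem_permSet, Equiv.symm_symm, Equiv.symm_apply_apply]

/-- Auxiliary (permSet permSet symm). [folklore] -/
private theorem permSet_permSet_symm (π : Equiv.Perm (Fin N)) {q : ℕ} (s : Set.powersetCard (Fin N) q) :
    permSet π (permSet π.symm s) = s := by
  apply Subtype.ext
  ext j
  rw [mem_permSet, mem_permSet, Equiv.symm_symm, Equiv.apply_symm_apply]

/-- `permSet π` as a permutation of the index sets. [cite: vanGeemen1994HodgeAV, proof of Thm. 6.12] -/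
def permSetEquiv (π : Equiv.Perm (Fin N)) (q : ℕ) : Equiv.Perm (Set.powersetCard (Fin N) q) where
  toFun := permSet π
  invFun := permSet π.symm
  left_inv := permSet_symm_permSet π
  right_inv := permSet_permSet_symm π

/-- **A monomial automorphism acts on monomials by monomials**: if `u bⱼ = cⱼ' b_{π j}` then
`⋀^q u (b_s) = ε • b_{π s}` with `ε ≠ 0` (reordering the permuted product costs a sign).
[cite: vanGeemen1994HodgeAV, proof of Thm. 6.12] -/
theorem extAct_monB_of_monomial (b : Module.Basis (Fin N) ℂ (complexBetti A.X 1))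
    (u : complexBetti A.X 1 →ₗ[ℂ] complexBetti A.X 1) (π : Equiv.Perm (Fin N)) (c : Fin N → ℂ)
    (hc : ∀ j, c j ≠ 0) (hu : ∀ j, u (b j) = c j • b (π j)) (q : ℕ) (s : Set.powersetCard (Fin N) q) :
    ∃ ε : ℂ, ε ≠ 0 ∧ extAct u q (monB b q s) = ε • monB b q (permSet π s) := by
  classical
  set e := Finset.orderEmbOfFin s.val s.prop with he
  set e' := Finset.orderEmbOfFin (permSet π s).val (permSet π s).prop with he'
  -- the permutation `ρ` of `Fin q` with `π (e r) = e' (ρ r)`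
  have hmem : ∀ r, π (e r) ∈ (permSet π s).val := fun r ↦ by
    rw [mem_permSet, Equiv.symm_apply_apply]; exact Finset.orderEmbOfFin_mem _ _ r
  let ρ₀ : Fin q → Fin q := fun r ↦ ((permSet π s).val.orderIsoOfFin (permSet π s).prop).symm ⟨π (e r), hmem r⟩
  have hρ₀ : ∀ r, e' (ρ₀ r) = π (e r) := fun r ↦ by
    have h1 := OrderIso.apply_symm_apply ((permSet π s).val.orderIsoOfFin (permSet π s).prop) ⟨π (e r), hmem r⟩
    have h2 := congrArg Subtype.val h1
    rw [Finset.coe_orderIsoOfFin_apply] at h2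
    exact h2
  have hinj : Function.Injective ρ₀ := fun r r' h ↦ by
    have h1 := congrArg e' h
    rw [hρ₀, hρ₀] at h1
    exact e.injective (π.injective h1)
  let ρ : Equiv.Perm (Fin q) := Equiv.ofBijective ρ₀ (Finite.injective_iff_bijective.1 hinj)
  refine ⟨(∏ r, c (e r)) * (Equiv.Perm.sign ρ : ℂ), mul_ne_zero (Finset.prod_ne_zero_iff.2 fun r _ ↦ hc _) ?_, ?_⟩
  · intro h0
    have h1 : ((Equiv.Perm.sign ρ : ℤ) : ℂ) * ((Equiv.Perm.sign ρ : ℤ) : ℂ) = 1 := by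
      rw [← Int.cast_mul, ← Units.val_mul, Int.units_mul_self, Units.val_one, Int.cast_one]
    rw [h0, zero_mul] at h1
    exact zero_ne_one h1
  rw [monB_apply, monB_apply, extAct_cupPowOne]
  simp_rw [hu]
  rw [MultilinearMap.map_smul_univ, mul_smul]
  congr 1
  have hfun : (fun r => b (π (e r))) = (fun r => b (e' r)) ∘ ρ := by
    funext r
    change b (π (e r)) = b (e' (ρ₀ r))
    rw [hρ₀]
  rw [hfun, ← cupPowOneAlt_apply, ← cupPowOneAlt_apply, AlternatingMap.map_perm, Units.smul_def,
    ← Int.cast_smul_eq_zsmul ℂ]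

/-- **The diagonal case**: if `u bⱼ = cⱼ bⱼ` then `⋀^q u (b_s) = (∏_{j ∈ s} cⱼ) • b_s`. [cite: vanGeemen1994HodgeAV, proof of Thm. 6.12] -/
theorem extAct_monB_of_diagonal (b : Module.Basis (Fin N) ℂ (complexBetti A.X 1))
    (u : complexBetti A.X 1 →ₗ[ℂ] complexBetti A.X 1) (c : Fin N → ℂ) (hu : ∀ j, u (b j) = c j • b j)
    (q : ℕ) (s : Set.powersetCard (Fin N) q) :
    extAct u q (monB b q s) = (∏ j ∈ s.val, c j) • monB b q s := by
  classical
  rw [monB_apply, extAct_cupPowOne]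
  simp_rw [hu]
  rw [MultilinearMap.map_smul_univ]
  congr 1
  conv_rhs => rw [← Finset.image_orderEmbOfFin_univ s.val s.prop]
  rw [Finset.prod_image (fun r _ r' _ h => (Finset.orderEmbOfFin s.val s.prop).injective h)]

/-- **Transport of coordinates under a monomial action**: if `L (B i) = εᵢ • B (P i)` for a bijection
`P` of the index set, then the `P i`-th coordinate of `L z` is `εᵢ` times the `i`-th coordinate of `z`.
[folklore] -/
private theorem repr_apply_of_monomial {ι M : Type*} [Fintype ι] [DecidableEq ι] [AddCommGroup M] [Module ℂ M]
    (B : Module.Basis ι ℂ M) (L : M →ₗ[ℂ] M) (P : Equiv.Perm ι) (ε : ι → ℂ)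
    (hL : ∀ i, L (B i) = ε i • B (P i)) (z : M) (i : ι) :
    B.repr (L z) (P i) = ε i * B.repr z i := by
  conv_lhs => rw [← B.sum_repr z, map_sum]
  simp_rw [map_smul, hL, smul_smul, map_sum, map_smul, B.repr_self, Finsupp.smul_single, smul_eq_mul, mul_one]
  rw [Finset.sum_apply', Finset.sum_eq_single i]
  · rw [Finsupp.single_eq_same, mul_comm]
  · intro j _ hj
    rw [Finsupp.single_eq_of_ne (fun h => hj (P.injective h).symm)]
  · intro h; exact absurd (Finset.mem_univ i) h

end Monomials

/-! ### E. Paired index sets, tops, torus weights, and the uniqueness of invariants -/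

section Invariants

variable {k : ℕ}

/-- The first-block projection `I(s) = {i | castAdd i ∈ s}` of an index set `s ⊆ Fin (k + k)`. [cite: vanGeemen1994HodgeAV, proof of Thm. 6.12] -/
def projW (s : Finset (Fin (k + k))) : Finset (Fin k) := Finset.univ.filter fun i => Fin.castAdd k i ∈ s

/-- Auxiliary (mem projW). [folklore] -/
@[simp] private theorem mem_projW {s : Finset (Fin (k + k))} {i : Fin k} : i ∈ projW s ↔ Fin.castAdd k i ∈ s := by
  simp [projW]

/-- `s` is PAIRED: `wᵢ` occurs in the monomial iff `w^*ᵢ` does (the monomials `∏_{i ∈ I} wᵢ ∧ w^*ᵢ`).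
[cite: vanGeemen1994HodgeAV, proof of Thm. 6.12] -/
def IsPaired (s : Finset (Fin (k + k))) : Prop := ∀ i, Fin.castAdd k i ∈ s ↔ Fin.natAdd k i ∈ s

/-- `s = {all wᵢ}`: the monomial `w₁ ∧ ⋯ ∧ w_{2n}` spanning `⋀^{2n}W`. [cite: vanGeemen1994HodgeAV, proof of Thm. 6.12] -/
def IsTopPlus (s : Finset (Fin (k + k))) : Prop := ∀ i, Fin.castAdd k i ∈ s ∧ Fin.natAdd k i ∉ s

/-- `s = {all w^*ᵢ}`: the monomial spanning `⋀^{2n}W^*`. [cite: vanGeemen1994HodgeAV, proof of Thm. 6.12] -/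
def IsTopMinus (s : Finset (Fin (k + k))) : Prop := ∀ i, Fin.natAdd k i ∈ s ∧ Fin.castAdd k i ∉ s

/-- Auxiliary (castAdd ne natAdd). [folklore] -/
private theorem castAdd_ne_natAdd (i j : Fin k) : Fin.castAdd k i ≠ Fin.natAdd k j := by
  intro h
  have h' := congrArg Fin.val h
  rw [Fin.val_castAdd, Fin.val_natAdd] at h'
  have := i.2
  omega

/-- Every index of `Fin (k + k)` is a `castAdd` or a `natAdd`. [folklore] -/
private theorem mem_iff_of_blocks {s t : Finset (Fin (k + k))}
    (h1 : ∀ i, Fin.castAdd k i ∈ s ↔ Fin.castAdd k i ∈ t) (h2 : ∀ j, Fin.natAdd k j ∈ s ↔ Fin.natAdd k j ∈ t) :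
    s = t := by
  ext p
  exact Fin.addCases (fun i ↦ h1 i) (fun j ↦ h2 j) p

/-- Auxiliary (castAdd mem map castAddEmb). [folklore] -/
private theorem castAdd_mem_map_castAddEmb {I : Finset (Fin k)} {i : Fin k} :
    Fin.castAdd k i ∈ I.map (Fin.castAddEmb k) ↔ i ∈ I := by
  rw [Finset.mem_map]
  constructor
  · rintro ⟨j, hj, hji⟩
    rwa [← Fin.castAdd_injective _ _ hji]
  · exact fun h ↦ ⟨i, h, rfl⟩

/-- Auxiliary (natAdd mem map natAddEmb). [folklore] -/
private theorem natAdd_mem_map_natAddEmb {I : Finset (Fin k)} {j : Fin k} :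
    Fin.natAdd k j ∈ I.map (Fin.natAddEmb k) ↔ j ∈ I := by
  rw [Finset.mem_map]
  constructor
  · rintro ⟨i, hi, hij⟩
    rwa [← Fin.natAdd_injective _ _ hij]
  · exact fun h ↦ ⟨j, h, rfl⟩

/-- Auxiliary (castAdd not mem map natAddEmb). [folklore] -/
private theorem castAdd_not_mem_map_natAddEmb {I : Finset (Fin k)} {i : Fin k} :
    Fin.castAdd k i ∉ I.map (Fin.natAddEmb k) := by
  rw [Finset.mem_map]
  rintro ⟨j, -, hj⟩
  exact castAdd_ne_natAdd i j hj.symm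

/-- Auxiliary (natAdd not mem map castAddEmb). [folklore] -/
private theorem natAdd_not_mem_map_castAddEmb {I : Finset (Fin k)} {j : Fin k} :
    Fin.natAdd k j ∉ I.map (Fin.castAddEmb k) := by
  rw [Finset.mem_map]
  rintro ⟨i, -, hi⟩
  exact castAdd_ne_natAdd i j hi

/-- A paired set is `castAdd(I) ∪ natAdd(I)` with `I = projW s`; its cardinality is `2 |I|`. [folklore] -/
private theorem card_eq_two_mul_of_isPaired {s : Finset (Fin (k + k))} (hs : IsPaired s) :
    s.card = 2 * (projW s).card := by
  classical
  have hs' : s = (projW s).map (Fin.castAddEmb k) ∪ (projW s).map (Fin.natAddEmb k) := by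
    refine mem_iff_of_blocks (fun i ↦ ?_) (fun j ↦ ?_)
    · rw [Finset.mem_union, castAdd_mem_map_castAddEmb, mem_projW]
      exact ⟨fun h ↦ Or.inl h, fun h ↦ h.elim id fun h' ↦ absurd h' castAdd_not_mem_map_natAddEmb⟩
    · rw [Finset.mem_union, natAdd_mem_map_natAddEmb, mem_projW, ← hs j]
      exact ⟨fun h ↦ Or.inr h, fun h ↦ h.elim (fun h' ↦ absurd h' natAdd_not_mem_map_castAddEmb) id⟩
  have hdisj : Disjoint ((projW s).map (Fin.castAddEmb k)) ((projW s).map (Fin.natAddEmb k)) := by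
    rw [Finset.disjoint_left]
    intro p hp hp'
    rw [Finset.mem_map] at hp hp'
    obtain ⟨i, -, rfl⟩ := hp
    obtain ⟨j, -, hj⟩ := hp'
    exact castAdd_ne_natAdd i j hj.symm
  conv_lhs => rw [hs']
  rw [Finset.card_union_of_disjoint hdisj, Finset.card_map, Finset.card_map, two_mul]

/-- Two paired sets with the same first-block projection are equal. [folklore] -/
private theorem eq_of_isPaired_of_projW_eq {s t : Finset (Fin (k + k))} (hs : IsPaired s) (ht : IsPaired t)
    (h : projW s = projW t) : s = t := by
  refine mem_iff_of_blocks (fun i ↦ ?_) (fun j ↦ ?_)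
  · rw [← mem_projW, ← mem_projW, h]
  · rw [← hs j, ← ht j, ← mem_projW, ← mem_projW, h]

/-- The image of a paired set under a block permutation `σ ⊕ σ` is paired, with projection `σ(I)`. [folklore] -/
private theorem isPaired_map_blockPerm {s : Finset (Fin (k + k))} (hs : IsPaired s) (σ : Equiv.Perm (Fin k)) :
    IsPaired (s.map (blockPerm σ).toEmbedding) ∧
      projW (s.map (blockPerm σ).toEmbedding) = (projW s).map σ.toEmbedding := by
  have key1 : ∀ i, Fin.castAdd k i ∈ s.map (blockPerm σ).toEmbedding ↔ Fin.castAdd k (σ.symm i) ∈ s := by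
    intro i
    rw [Finset.mem_map_equiv, show (blockPerm σ).symm (Fin.castAdd k i) = Fin.castAdd k (σ.symm i) from by
      rw [Equiv.symm_apply_eq, blockPerm_castAdd, Equiv.apply_symm_apply]]
  have key2 : ∀ j, Fin.natAdd k j ∈ s.map (blockPerm σ).toEmbedding ↔ Fin.natAdd k (σ.symm j) ∈ s := by
    intro j
    rw [Finset.mem_map_equiv, show (blockPerm σ).symm (Fin.natAdd k j) = Fin.natAdd k (σ.symm j) from by
      rw [Equiv.symm_apply_eq, blockPerm_natAdd, Equiv.apply_symm_apply]]
  refine ⟨fun i ↦ by rw [key1, key2, hs], ?_⟩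
  ext i
  rw [mem_projW, key1, Finset.mem_map_equiv, mem_projW]

variable {m d : ℕ} {A : AbelianVariety ℂ}
variable (hm : 1 ≤ m) (hA : A.dim = m + 1) (hd : 0 < d) {φ : A ⟶ A} (hφ : φ ≫ φ = -(d • 𝟙 A))
  (e : ProjectiveEmbedding A.X) {a : complexBetti (projectiveSpace e.n ℂ) 2} (ha : IsRationalClass a)
  (ha0 : a ≠ 0) (w : Module.Basis (Fin k) ℂ (eigW A φ d))

/-- The unit `2 ∈ ℂˣ`. [folklore] -/
private def two' : ℂˣ := Units.mk0 (2 : ℂ) two_ne_zero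

/-- Auxiliary (coe two'). [folklore] -/
@[simp] private theorem coe_two' : ((two' : ℂˣ) : ℂ) = 2 := rfl

/-- Torus weights `t_{i₀} = 2`, `t_{i₁} = 1/2`, `tᵢ = 1` otherwise. [cite: vanGeemen1994HodgeAV, proof of Thm. 6.12] -/
def torusWt (i₀ i₁ : Fin k) : Fin k → ℂˣ :=
  Function.update (Function.update (fun _ => 1) i₀ two') i₁ two'⁻¹

/-- The units of the torus element on the Weil basis: `t` on `w`, `t⁻¹` on `w^*`. [cite: vanGeemen1994HodgeAV, proof of Thm. 6.12] -/
def torusUnits (i₀ i₁ : Fin k) : Fin (k + k) → ℂˣ :=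
  Fin.append (torusWt i₀ i₁) (fun i => (torusWt i₀ i₁ i)⁻¹)

/-- Auxiliary (torusUnits castAdd). [folklore] -/
@[simp] private theorem torusUnits_castAdd (i₀ i₁ i : Fin k) : torusUnits i₀ i₁ (Fin.castAdd k i) = torusWt i₀ i₁ i := by
  rw [torusUnits, Fin.append_left]

/-- Auxiliary (torusUnits natAdd). [folklore] -/
@[simp] private theorem torusUnits_natAdd (i₀ i₁ i : Fin k) :
    torusUnits i₀ i₁ (Fin.natAdd k i) = (torusWt i₀ i₁ i)⁻¹ := by
  rw [torusUnits, Fin.append_right]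

/-- Auxiliary (blockPerm one). [folklore] -/
private theorem blockPerm_one : blockPerm (1 : Equiv.Perm (Fin k)) = 1 := by
  ext p
  refine Fin.addCases (fun i ↦ ?_) (fun j ↦ ?_) p
  · rw [blockPerm_castAdd]; rfl
  · rw [blockPerm_natAdd]; rfl

/-- **The diagonal torus element `diag(t) ⊕ diag(t⁻¹)` of `SU_H(ℂ)`**, `∏ tᵢ = 1`.
[cite: vanGeemen1994HodgeAV, Lemma 6.10 and proof of Thm. 6.12] -/
def torusAuto (i₀ i₁ : Fin k) : complexBetti A.X 1 ≃ₗ[ℂ] complexBetti A.X 1 :=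
  monoAuto hm hA hd hφ e ha ha0 w 1 (torusUnits i₀ i₁)

/-- Auxiliary (torusAuto weilBasis). [folklore] -/
private theorem torusAuto_weilBasis (i₀ i₁ : Fin k) (p : Fin (k + k)) :
    torusAuto hm hA hd hφ e ha ha0 w i₀ i₁ (weilBasis hm hA hd hφ e ha ha0 w p) =
      (torusUnits i₀ i₁ p : ℂ) • weilBasis hm hA hd hφ e ha ha0 w p := by
  rw [torusAuto, monoAuto_weilBasis, blockPerm_one, Equiv.Perm.one_apply]

/-- Auxiliary (torusWt fst). [folklore] -/
private theorem torusWt_fst {i₀ i₁ : Fin k} (hne : i₀ ≠ i₁) : (torusWt i₀ i₁ i₀ : ℂ) = 2 := by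
  rw [torusWt, Function.update_of_ne hne, Function.update_self, coe_two']

/-- Auxiliary (torusWt snd). [folklore] -/
private theorem torusWt_snd (i₀ i₁ : Fin k) : (torusWt i₀ i₁ i₁ : ℂ) = 2⁻¹ := by
  rw [torusWt, Function.update_self, Units.val_inv_eq_inv_val, coe_two']

/-- Auxiliary (torusWt other). [folklore] -/
private theorem torusWt_other {i₀ i₁ c : Fin k} (h₀ : c ≠ i₀) (h₁ : c ≠ i₁) : (torusWt i₀ i₁ c : ℂ) = 1 := by
  rw [torusWt, Function.update_of_ne h₁, Function.update_of_ne h₀, Units.val_one]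

/-- Auxiliary (prod torusWt). [folklore] -/
private theorem prod_torusWt {i₀ i₁ : Fin k} (hne : i₀ ≠ i₁) : ∏ i, (torusWt i₀ i₁ i : ℂ) = 1 := by
  rw [Finset.prod_eq_mul i₀ i₁ hne, torusWt_fst hne, torusWt_snd, mul_inv_cancel₀ (two_ne_zero' ℂ)]
  · intro c _ hc
    exact torusWt_other hc.1 hc.2
  · intro h; exact absurd (Finset.mem_univ _) h
  · intro h; exact absurd (Finset.mem_univ _) h

/-- The torus element lies in `SU_H(ℂ)`. [cite: vanGeemen1994HodgeAV, Lemma 6.10] -/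
theorem torusAuto_mem (n' d' : ℕ) (hn' : 2 * n' - 1 = m) (hd' : d' = d) {i₀ i₁ : Fin k} (hne : i₀ ≠ i₁) :
    torusAuto hm hA hd hφ e ha ha0 w i₀ i₁ ∈ weilSpecialUnitaryGroup A φ n' d'
      ((d : ℂ) • complexBetti.map e.ι 2 a + complexBetti.map φ.hom.hom.hom 2 (complexBetti.map e.ι 2 a)) := by
  refine monoAuto_mem_weilSpecialUnitaryGroup hm hA hd hφ e ha ha0 w n' d' hn' hd' 1 _ (fun i ↦ ?_) ?_
  · rw [torusUnits_castAdd, torusUnits_natAdd, Units.val_inv_eq_inv_val, mul_inv_cancel₀ (Units.ne_zero _)]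
  · rw [Equiv.Perm.sign_one, Units.val_one, Int.cast_one, one_mul]
    simp_rw [torusUnits_castAdd]
    exact prod_torusWt hne

/-- The torus weight of an index set. [cite: vanGeemen1994HodgeAV, proof of Thm. 6.12] -/
def torusWeight (i₀ i₁ : Fin k) (s : Finset (Fin (k + k))) : ℂ := ∏ j ∈ s, (torusUnits i₀ i₁ j : ℂ)

/-- **The torus acts diagonally on the monomial basis** with eigenvalue the torus weight.
[cite: vanGeemen1994HodgeAV, proof of Thm. 6.12] -/
theorem extAct_torusAuto_monB (i₀ i₁ : Fin k) (q : ℕ) (s : Set.powersetCard (Fin (k + k)) q) :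
    extAct (torusAuto hm hA hd hφ e ha ha0 w i₀ i₁ : complexBetti A.X 1 →ₗ[ℂ] complexBetti A.X 1) q
      (monB (weilBasis hm hA hd hφ e ha ha0 w) q s) =
      torusWeight i₀ i₁ s.val • monB (weilBasis hm hA hd hφ e ha ha0 w) q s :=
  extAct_monB_of_diagonal _ _ _ (fun p ↦ by rw [LinearEquiv.coe_coe, torusAuto_weilBasis]) q s

/-- The local weight factor of an index `i` for an index set `s`. [folklore] -/
private def wtFactor (s : Finset (Fin (k + k))) (t : ℂ) (i : Fin k) : ℂ :=
  (if Fin.castAdd k i ∈ s then t else 1) * (if Fin.natAdd k i ∈ s then t⁻¹ else 1)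

/-- The torus weight as a product of the two local factors at `i₀` (parameter `2`) and `i₁` (parameter `1/2`). [folklore] -/
private theorem torusWeight_eq {i₀ i₁ : Fin k} (hne : i₀ ≠ i₁) (s : Finset (Fin (k + k))) :
    torusWeight i₀ i₁ s = wtFactor s 2 i₀ * wtFactor s 2⁻¹ i₁ := by
  classical
  have h1 : torusWeight i₀ i₁ s = ∏ j : Fin (k + k), (if j ∈ s then (torusUnits i₀ i₁ j : ℂ) else 1) := by
    rw [torusWeight, Finset.prod_ite_mem, Finset.univ_inter]
  rw [h1, Fin.prod_univ_add]
  simp_rw [torusUnits_castAdd, torusUnits_natAdd, Units.val_inv_eq_inv_val]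
  rw [← Finset.prod_mul_distrib, Finset.prod_eq_mul i₀ i₁ hne]
  · rw [torusWt_fst hne, torusWt_snd]
    simp only [wtFactor, inv_inv]
  · intro c _ hc
    rw [torusWt_other hc.1 hc.2, inv_one, ite_self, ite_self, mul_one]
  · intro h; exact absurd (Finset.mem_univ _) h
  · intro h; exact absurd (Finset.mem_univ _) h

/-- **Torus weights detect the non-paired, non-top monomials**: if `s` is neither paired nor a top, some
torus element of `SU_H(ℂ)` acts on `b_s` with weight `≠ 1`. [cite: vanGeemen1994HodgeAV, proof of Thm. 6.12] -/
theorem exists_torusWeight_ne_one {s : Finset (Fin (k + k))} (hs : ¬IsPaired s) (hs1 : ¬IsTopPlus s)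
    (hs2 : ¬IsTopMinus s) : ∃ i₀ i₁ : Fin k, i₀ ≠ i₁ ∧ torusWeight i₀ i₁ s ≠ 1 := by
  classical
  by_contra H
  simp only [not_exists, not_and, ne_eq, not_not] at H
  obtain ⟨i₀, hi₀⟩ := not_forall.1 hs
  -- the weight equations at every other index
  have key : ∀ i, i ≠ i₀ → wtFactor s 2 i₀ * wtFactor s 2⁻¹ i = 1 := fun i hi ↦ by
    rw [← torusWeight_eq (Ne.symm hi)]; exact H i₀ i (Ne.symm hi)
  by_cases hA0 : Fin.castAdd k i₀ ∈ s
  · have hB0 : Fin.natAdd k i₀ ∉ s := fun h ↦ hi₀ ⟨fun _ ↦ h, fun _ ↦ hA0⟩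
    apply hs1
    intro i
    by_cases hi : i = i₀
    · subst hi; exact ⟨hA0, hB0⟩
    have hw := key i hi
    simp only [wtFactor, if_pos hA0, if_neg hB0] at hw
    by_cases h1 : Fin.castAdd k i ∈ s <;> by_cases h2 : Fin.natAdd k i ∈ s <;>
      simp only [h1, h2, if_true, if_false] at hw <;> norm_num at hw
    exact ⟨h1, h2⟩
  · have hB0 : Fin.natAdd k i₀ ∈ s := by
      by_contra h; exact hi₀ ⟨fun h' ↦ absurd h' hA0, fun h' ↦ absurd h' h⟩
    apply hs2
    intro i
    by_cases hi : i = i₀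
    · subst hi; exact ⟨hB0, hA0⟩
    have hw := key i hi
    simp only [wtFactor, if_neg hA0, if_pos hB0] at hw
    by_cases h1 : Fin.castAdd k i ∈ s <;> by_cases h2 : Fin.natAdd k i ∈ s <;>
      simp only [h1, h2, if_true, if_false] at hw <;> norm_num at hw
    exact ⟨h2, h1⟩

/-- Units of the signed transposition: `-1` at `w_x` and at `w^*_x`, `1` elsewhere. [folklore] -/
private def swapUnits (x : Fin k) : Fin (k + k) → ℂˣ :=
  Fin.append (Function.update (fun _ => (1 : ℂˣ)) x (-1)) (Function.update (fun _ => (1 : ℂˣ)) x (-1))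

/-- Auxiliary (swapUnits castAdd). [folklore] -/
private theorem swapUnits_castAdd (x i : Fin k) :
    swapUnits x (Fin.castAdd k i) = Function.update (fun _ => (1 : ℂˣ)) x (-1) i := by
  rw [swapUnits, Fin.append_left]

/-- Auxiliary (swapUnits natAdd). [folklore] -/
private theorem swapUnits_natAdd (x i : Fin k) :
    swapUnits x (Fin.natAdd k i) = Function.update (fun _ => (1 : ℂˣ)) x (-1) i := by
  rw [swapUnits, Fin.append_right]

/-- Auxiliary (coe update neg one). [folklore] -/
private theorem coe_update_neg_one (x i : Fin k) :
    ((Function.update (fun _ => (1 : ℂˣ)) x (-1) i : ℂˣ) : ℂ) = if i = x then -1 else 1 := by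
  rw [Function.update_apply]
  split_ifs <;> simp

/-- **The signed transposition `w_x ↦ -w_y ↦ …` of `SU_H(ℂ)`** (a determinant-one lift of the
transposition `(x y)` acting on `W` and contragrediently on `W̄`). [cite: vanGeemen1994HodgeAV, Lemma 6.10 and proof of Thm. 6.12] -/
def swapAuto (x y : Fin k) : complexBetti A.X 1 ≃ₗ[ℂ] complexBetti A.X 1 :=
  monoAuto hm hA hd hφ e ha ha0 w (Equiv.swap x y) (swapUnits x)

/-- The signed transposition lies in `SU_H(ℂ)`. [cite: vanGeemen1994HodgeAV, Lemma 6.10] -/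
theorem swapAuto_mem (n' d' : ℕ) (hn' : 2 * n' - 1 = m) (hd' : d' = d) {x y : Fin k} (hxy : x ≠ y) :
    swapAuto hm hA hd hφ e ha ha0 w x y ∈ weilSpecialUnitaryGroup A φ n' d'
      ((d : ℂ) • complexBetti.map e.ι 2 a + complexBetti.map φ.hom.hom.hom 2 (complexBetti.map e.ι 2 a)) := by
  classical
  refine monoAuto_mem_weilSpecialUnitaryGroup hm hA hd hφ e ha ha0 w n' d' hn' hd' _ _ (fun i ↦ ?_) ?_
  · rw [swapUnits_castAdd, swapUnits_natAdd, coe_update_neg_one]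
    split_ifs <;> norm_num
  · rw [Equiv.Perm.sign_swap hxy, Units.val_neg, Units.val_one, Int.cast_neg, Int.cast_one]
    simp_rw [swapUnits_castAdd, coe_update_neg_one]
    rw [Finset.prod_ite_eq' Finset.univ x (fun _ => (-1 : ℂ))]
    simp

/-- The signed transposition acts on monomials by monomials, up to a non-zero scalar. [cite: vanGeemen1994HodgeAV, proof of Thm. 6.12] -/
theorem extAct_swapAuto_monB (x y : Fin k) (q : ℕ) (s : Set.powersetCard (Fin (k + k)) q) :
    ∃ ε : ℂ, ε ≠ 0 ∧
      extAct (swapAuto hm hA hd hφ e ha ha0 w x y : complexBetti A.X 1 →ₗ[ℂ] complexBetti A.X 1) q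
        (monB (weilBasis hm hA hd hφ e ha ha0 w) q s) =
      ε • monB (weilBasis hm hA hd hφ e ha ha0 w) q (permSet (blockPerm (Equiv.swap x y)) s) :=
  extAct_monB_of_monomial _ _ (blockPerm (Equiv.swap x y))
    (fun p ↦ (swapUnits x (blockPerm (Equiv.swap x y) p) : ℂ)) (fun _ ↦ Units.ne_zero _)
    (fun p ↦ by rw [LinearEquiv.coe_coe, swapAuto, monoAuto_weilBasis]) q s

/-- Auxiliary (blockPerm symm). [folklore] -/
private theorem blockPerm_symm (σ : Equiv.Perm (Fin k)) : (blockPerm σ).symm = blockPerm σ.symm := by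
  refine Equiv.ext fun p ↦ ?_
  rw [Equiv.symm_apply_eq]
  refine Fin.addCases (fun i ↦ ?_) (fun j ↦ ?_) p
  · rw [blockPerm_castAdd, blockPerm_castAdd, Equiv.apply_symm_apply]
  · rw [blockPerm_natAdd, blockPerm_natAdd, Equiv.apply_symm_apply]

/-- **Torus invariance kills the non-paired, non-top coordinates.** [cite: vanGeemen1994HodgeAV, proof of Thm. 6.12] -/
theorem repr_eq_zero_of_not_isPaired {q : ℕ} (z : complexBetti A.X q)
    (hT : ∀ i₀ i₁ : Fin k, i₀ ≠ i₁ →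
      extAct (torusAuto hm hA hd hφ e ha ha0 w i₀ i₁ : complexBetti A.X 1 →ₗ[ℂ] complexBetti A.X 1) q z = z)
    (s : Set.powersetCard (Fin (k + k)) q) (hs : ¬IsPaired s.val) (ht1 : ¬IsTopPlus s.val) (ht2 : ¬IsTopMinus s.val) :
    (monB (weilBasis hm hA hd hφ e ha ha0 w) q).repr z s = 0 := by
  classical
  set B := monB (weilBasis hm hA hd hφ e ha ha0 w) q with hB
  obtain ⟨i₀, i₁, hne, hw⟩ := exists_torusWeight_ne_one hs ht1 ht2
  have h := repr_apply_of_monomial B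
    (extAct (torusAuto hm hA hd hφ e ha ha0 w i₀ i₁ : complexBetti A.X 1 →ₗ[ℂ] complexBetti A.X 1) q)
    1 (fun s ↦ torusWeight i₀ i₁ s.val)
    (fun s ↦ by rw [Equiv.Perm.one_apply]; exact extAct_torusAuto_monB hm hA hd hφ e ha ha0 w i₀ i₁ q s) z s
  rw [Equiv.Perm.one_apply, hT i₀ i₁ hne] at h
  have h' : (torusWeight i₀ i₁ s.val - 1) * B.repr z s = 0 := by rw [sub_mul, one_mul, ← h, sub_self]
  exact (mul_eq_zero.1 h').resolve_left (sub_ne_zero.2 hw)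

/-- **Uniqueness of invariants.** Let `z ∈ H^q(A(ℂ); ℂ)` be fixed by the exterior action of every
diagonal torus element and every signed transposition. If the coordinate of `z` at ONE paired
monomial `b_{s₀}` vanishes and its coordinates at the top monomials vanish, then `z = 0`: torus
weights kill the non-paired non-top coordinates, and the signed transpositions act transitively on
the paired monomials of a given degree. (The combinatorial core of "`(∧^{2p}V_ℂ)^{SL(W)}` is spanned
by `Eᵖ`, `∧^{2n}W`, `∧^{2n}W^*`", van Geemen, proof of Thm. 6.12.) [cite: vanGeemen1994HodgeAV, proof of Thm. 6.12] -/
theorem eq_zero_of_invariant {q : ℕ} (z : complexBetti A.X q)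
    (hT : ∀ i₀ i₁ : Fin k, i₀ ≠ i₁ →
      extAct (torusAuto hm hA hd hφ e ha ha0 w i₀ i₁ : complexBetti A.X 1 →ₗ[ℂ] complexBetti A.X 1) q z = z)
    (hS : ∀ x y : Fin k, x ≠ y →
      extAct (swapAuto hm hA hd hφ e ha ha0 w x y : complexBetti A.X 1 →ₗ[ℂ] complexBetti A.X 1) q z = z)
    (s₀ : Set.powersetCard (Fin (k + k)) q) (hs₀ : IsPaired s₀.val)
    (h0 : (monB (weilBasis hm hA hd hφ e ha ha0 w) q).repr z s₀ = 0)
    (htop : ∀ s : Set.powersetCard (Fin (k + k)) q, IsTopPlus s.val ∨ IsTopMinus s.val →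
      (monB (weilBasis hm hA hd hφ e ha ha0 w) q).repr z s = 0) : z = 0 := by
  classical
  set B := monB (weilBasis hm hA hd hφ e ha ha0 w) q with hB
  -- (1) non-paired, non-top coordinates vanish (torus)
  have hnp : ∀ s : Set.powersetCard (Fin (k + k)) q, ¬IsPaired s.val → B.repr z s = 0 := by
    intro s hs
    by_cases ht : IsTopPlus s.val ∨ IsTopMinus s.val
    · exact htop s ht
    obtain ⟨ht1, ht2⟩ := not_or.1 ht
    exact repr_eq_zero_of_not_isPaired hm hA hd hφ e ha ha0 w z hT s hs ht1 ht2
  -- (2) transport along a signed transposition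
  have hswap : ∀ x y : Fin k, x ≠ y → ∀ s : Set.powersetCard (Fin (k + k)) q,
      B.repr z s = 0 → B.repr z (permSet (blockPerm (Equiv.swap x y)) s) = 0 := by
    intro x y hxy s hs
    choose ε _ hε' using extAct_swapAuto_monB hm hA hd hφ e ha ha0 w x y q
    have h := repr_apply_of_monomial B
      (extAct (swapAuto hm hA hd hφ e ha ha0 w x y : complexBetti A.X 1 →ₗ[ℂ] complexBetti A.X 1) q)
      (permSetEquiv (blockPerm (Equiv.swap x y)) q) ε (fun s ↦ hε' s) z s
    rw [hS x y hxy, hs, mul_zero] at h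
    exact h
  -- (3) paired coordinates vanish, by induction on the distance of the projection to `projW s₀`
  set I₀ := projW s₀.val with hI₀
  have hpaired : ∀ r : ℕ, ∀ s : Set.powersetCard (Fin (k + k)) q, IsPaired s.val →
      (projW s.val \ I₀).card = r → B.repr z s = 0 := by
    intro r
    induction r with
    | zero =>
      intro s hs hr
      have hsub : projW s.val ⊆ I₀ := Finset.sdiff_eq_empty_iff_subset.1 (Finset.card_eq_zero.1 hr)
      have hcard : (projW s.val).card = I₀.card := by
        have h1 := card_eq_two_mul_of_isPaired hs
        have h2 := card_eq_two_mul_of_isPaired hs₀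
        rw [Set.powersetCard.card_eq] at h1 h2
        rw [← hI₀] at h2
        omega
      have heq : projW s.val = I₀ := Finset.eq_of_subset_of_card_le hsub hcard.ge
      have hss : s = s₀ := Subtype.ext (eq_of_isPaired_of_projW_eq hs hs₀ heq)
      rw [hss]; exact h0
    | succ r ih =>
      intro s hs hr
      -- pick `y ∈ projW s \ I₀` and `x ∈ I₀ \ projW s`
      obtain ⟨y, hy⟩ : (projW s.val \ I₀).Nonempty := Finset.card_pos.1 (by omega)
      have hcard : (projW s.val).card = I₀.card := by
        have h1 := card_eq_two_mul_of_isPaired hs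
        have h2 := card_eq_two_mul_of_isPaired hs₀
        rw [Set.powersetCard.card_eq] at h1 h2
        rw [← hI₀] at h2
        omega
      obtain ⟨x, hx⟩ : (I₀ \ projW s.val).Nonempty := by
        rw [← Finset.card_pos, Finset.card_sdiff_comm hcard.symm]; omega
      rw [Finset.mem_sdiff] at hx hy
      have hxy : x ≠ y := fun h ↦ hx.2 (h ▸ hy.1)
      -- the swapped set `s'`
      set π := blockPerm (Equiv.swap x y) with hπ
      set s' := permSet π s with hs'
      have hP := isPaired_map_blockPerm hs (Equiv.swap x y)
      have hs'P : IsPaired s'.val := hP.1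
      have hproj : projW s'.val = (projW s.val).map (Equiv.swap x y).toEmbedding := hP.2
      have hr' : (projW s'.val \ I₀).card = r := by
        have hset : projW s'.val \ I₀ = (projW s.val \ I₀).erase y := by
          ext i
          rw [hproj, Finset.mem_sdiff, Finset.mem_map_equiv, Equiv.symm_swap, Finset.mem_erase, Finset.mem_sdiff]
          by_cases hix : i = x
          · subst hix
            rw [Equiv.swap_apply_left]
            exact ⟨fun h ↦ absurd hx.1 h.2, fun h ↦ absurd h.2.1 hx.2⟩
          by_cases hiy : i = y
          · subst hiy
            rw [Equiv.swap_apply_right]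
            exact ⟨fun h ↦ absurd h.1 hx.2, fun h ↦ absurd rfl h.1⟩
          rw [Equiv.swap_apply_of_ne_of_ne hix hiy]
          exact ⟨fun h ↦ ⟨hiy, h⟩, fun h ↦ h.2⟩
        rw [hset, Finset.card_erase_of_mem (Finset.mem_sdiff.2 hy), hr]
        rfl
      have hz' : B.repr z s' = 0 := ih s' hs'P hr'
      have h := hswap x y hxy s' hz'
      have hback : permSet π s' = s := by
        have hππ : π.symm = π := by rw [hπ, blockPerm_symm, Equiv.symm_swap]
        have h1 := permSet_symm_permSet π s
        rwa [hππ] at h1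
      rwa [hback] at h
  -- conclusion
  refine B.repr.injective (Finsupp.ext fun s ↦ ?_)
  rw [map_zero, Finsupp.zero_apply]
  by_cases hs : IsPaired s.val
  · exact hpaired _ s hs rfl
  · exact hnp s hs

end Invariants

/-! ### F. Special index sets: pairs, the reference paired set, the two tops; the scaling element -/

section Special

variable {k : ℕ}

/-- The paired set `castAdd(I) ∪ natAdd(I)` of a set `I ⊆ Fin k`. [folklore] -/
private def pairedSet (I : Finset (Fin k)) : Finset (Fin (k + k)) := I.map (Fin.castAddEmb k) ∪ I.map (Fin.natAddEmb k)

/-- Auxiliary (castAdd mem pairedSet). [folklore] -/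
private theorem castAdd_mem_pairedSet {I : Finset (Fin k)} {i : Fin k} : Fin.castAdd k i ∈ pairedSet I ↔ i ∈ I := by
  rw [pairedSet, Finset.mem_union, castAdd_mem_map_castAddEmb]
  exact ⟨fun h ↦ h.elim id fun h' ↦ absurd h' castAdd_not_mem_map_natAddEmb, fun h ↦ Or.inl h⟩

/-- Auxiliary (natAdd mem pairedSet). [folklore] -/
private theorem natAdd_mem_pairedSet {I : Finset (Fin k)} {j : Fin k} : Fin.natAdd k j ∈ pairedSet I ↔ j ∈ I := by
  rw [pairedSet, Finset.mem_union, natAdd_mem_map_natAddEmb]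
  exact ⟨fun h ↦ h.elim (fun h' ↦ absurd h' natAdd_not_mem_map_castAddEmb) id, fun h ↦ Or.inr h⟩

/-- Auxiliary (isPaired pairedSet). [folklore] -/
private theorem isPaired_pairedSet (I : Finset (Fin k)) : IsPaired (pairedSet I) := fun i ↦ by
  rw [castAdd_mem_pairedSet, natAdd_mem_pairedSet]

/-- Auxiliary (projW pairedSet). [folklore] -/
private theorem projW_pairedSet (I : Finset (Fin k)) : projW (pairedSet I) = I := by
  ext i; rw [mem_projW, castAdd_mem_pairedSet]

/-- Auxiliary (card pairedSet). [folklore] -/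
private theorem card_pairedSet (I : Finset (Fin k)) : (pairedSet I).card = 2 * I.card := by
  rw [card_eq_two_mul_of_isPaired (isPaired_pairedSet I), projW_pairedSet]

/-- The paired set of `I` as an index of the degree-`2|I|` monomial basis. [folklore] -/
private def pairedIdx (I : Finset (Fin k)) {q : ℕ} (hq : 2 * I.card = q) : Set.powersetCard (Fin (k + k)) q :=
  Set.powersetCard.ofCard (s := pairedSet I) (by rw [card_pairedSet, hq])

/-- Auxiliary (pairedIdx val). [folklore] -/
@[simp] private theorem pairedIdx_val (I : Finset (Fin k)) {q : ℕ} (hq : 2 * I.card = q) : (pairedIdx I hq).val = pairedSet I := rfl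

/-- The reference `p`-subset `{0, …, p-1} ⊆ Fin k` (`p ≤ k`). [folklore] -/
private def refSubset (p : ℕ) (hp : p ≤ k) : Finset (Fin k) := (Finset.univ : Finset (Fin p)).map (Fin.castLEEmb hp)

/-- Auxiliary (card refSubset). [folklore] -/
private theorem card_refSubset (p : ℕ) (hp : p ≤ k) : (refSubset p hp).card = p := by
  rw [refSubset, Finset.card_map, Finset.card_univ, Fintype.card_fin]

/-- The reference paired index of degree `2p`. [cite: vanGeemen1994HodgeAV, proof of Thm. 6.12] -/
def refIdx (p : ℕ) (hp : p ≤ k) : Set.powersetCard (Fin (k + k)) (2 * p) :=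
  pairedIdx (refSubset p hp) (by rw [card_refSubset])

/-- Auxiliary (isPaired refIdx). [folklore] -/
private theorem isPaired_refIdx (p : ℕ) (hp : p ≤ k) : IsPaired (refIdx p hp : Set.powersetCard (Fin (k + k)) (2 * p)).val :=
  isPaired_pairedSet _

/-- The top index `{castAdd i | i}` (the monomial `w₁ ∧ ⋯ ∧ w_k`). [cite: vanGeemen1994HodgeAV, proof of Thm. 6.12] -/
def topPlusIdx (k : ℕ) : Set.powersetCard (Fin (k + k)) k :=
  Set.powersetCard.ofCard (s := (Finset.univ : Finset (Fin k)).map (Fin.castAddEmb k))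
    (by rw [Finset.card_map, Finset.card_univ, Fintype.card_fin])

/-- The top index `{natAdd j | j}` (the monomial `w^*₁ ∧ ⋯ ∧ w^*_k`). [cite: vanGeemen1994HodgeAV, proof of Thm. 6.12] -/
def topMinusIdx (k : ℕ) : Set.powersetCard (Fin (k + k)) k :=
  Set.powersetCard.ofCard (s := (Finset.univ : Finset (Fin k)).map (Fin.natAddEmb k))
    (by rw [Finset.card_map, Finset.card_univ, Fintype.card_fin])

/-- Auxiliary (castAdd mem topPlusIdx). [folklore] -/
private theorem castAdd_mem_topPlusIdx (i : Fin k) : Fin.castAdd k i ∈ (topPlusIdx k).val :=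
  castAdd_mem_map_castAddEmb.2 (Finset.mem_univ i)

/-- Auxiliary (natAdd not mem topPlusIdx). [folklore] -/
private theorem natAdd_not_mem_topPlusIdx (j : Fin k) : Fin.natAdd k j ∉ (topPlusIdx k).val :=
  natAdd_not_mem_map_castAddEmb

/-- Auxiliary (natAdd mem topMinusIdx). [folklore] -/
private theorem natAdd_mem_topMinusIdx (j : Fin k) : Fin.natAdd k j ∈ (topMinusIdx k).val :=
  natAdd_mem_map_natAddEmb.2 (Finset.mem_univ j)

/-- Auxiliary (castAdd not mem topMinusIdx). [folklore] -/
private theorem castAdd_not_mem_topMinusIdx (i : Fin k) : Fin.castAdd k i ∉ (topMinusIdx k).val :=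
  castAdd_not_mem_map_natAddEmb

/-- Auxiliary (isTopPlus topPlusIdx). [folklore] -/
private theorem isTopPlus_topPlusIdx : IsTopPlus (topPlusIdx k).val := fun i ↦
  ⟨castAdd_mem_topPlusIdx i, natAdd_not_mem_topPlusIdx i⟩

/-- Auxiliary (isTopMinus topMinusIdx). [folklore] -/
private theorem isTopMinus_topMinusIdx : IsTopMinus (topMinusIdx k).val := fun i ↦
  ⟨natAdd_mem_topMinusIdx i, castAdd_not_mem_topMinusIdx i⟩

/-- A top set has cardinality `k`. [folklore] -/
private theorem card_eq_of_isTopPlus {s : Finset (Fin (k + k))} (hs : IsTopPlus s) : s.card = k := by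
  have h : s = (topPlusIdx k).val :=
    mem_iff_of_blocks (fun i ↦ ⟨fun _ ↦ castAdd_mem_topPlusIdx i, fun _ ↦ (hs i).1⟩)
      (fun j ↦ ⟨fun h ↦ absurd h (hs j).2, fun h ↦ absurd h (natAdd_not_mem_topPlusIdx j)⟩)
  rw [h]; exact (topPlusIdx k).prop

/-- Auxiliary (card eq of isTopMinus). [folklore] -/
private theorem card_eq_of_isTopMinus {s : Finset (Fin (k + k))} (hs : IsTopMinus s) : s.card = k := by
  have h : s = (topMinusIdx k).val :=
    mem_iff_of_blocks (fun i ↦ ⟨fun h ↦ absurd h (hs i).2, fun h ↦ absurd h (castAdd_not_mem_topMinusIdx i)⟩)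
      (fun j ↦ ⟨fun _ ↦ natAdd_mem_topMinusIdx j, fun _ ↦ (hs j).1⟩)
  rw [h]; exact (topMinusIdx k).prop

/-- Auxiliary (eq topPlusIdx of isTopPlus). [folklore] -/
private theorem eq_topPlusIdx_of_isTopPlus {s : Set.powersetCard (Fin (k + k)) k} (hs : IsTopPlus s.val) : s = topPlusIdx k :=
  Subtype.ext (mem_iff_of_blocks (fun i ↦ ⟨fun _ ↦ castAdd_mem_topPlusIdx i, fun _ ↦ (hs i).1⟩)
    (fun j ↦ ⟨fun h ↦ absurd h (hs j).2, fun h ↦ absurd h (natAdd_not_mem_topPlusIdx j)⟩))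

/-- Auxiliary (eq topMinusIdx of isTopMinus). [folklore] -/
private theorem eq_topMinusIdx_of_isTopMinus {s : Set.powersetCard (Fin (k + k)) k} (hs : IsTopMinus s.val) :
    s = topMinusIdx k :=
  Subtype.ext (mem_iff_of_blocks (fun i ↦ ⟨fun h ↦ absurd h (hs i).2, fun h ↦ absurd h (castAdd_not_mem_topMinusIdx i)⟩)
    (fun j ↦ ⟨fun _ ↦ natAdd_mem_topMinusIdx j, fun _ ↦ (hs j).1⟩))

/-- Auxiliary (not isPaired topPlusIdx). [folklore] -/
private theorem not_isPaired_topPlusIdx (hk : 0 < k) : ¬IsPaired (topPlusIdx k).val := fun h ↦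
  natAdd_not_mem_topPlusIdx (k := k) ⟨0, hk⟩ ((h ⟨0, hk⟩).1 (castAdd_mem_topPlusIdx _))

/-- Auxiliary (not isPaired topMinusIdx). [folklore] -/
private theorem not_isPaired_topMinusIdx (hk : 0 < k) : ¬IsPaired (topMinusIdx k).val := fun h ↦
  castAdd_not_mem_topMinusIdx (k := k) ⟨0, hk⟩ ((h ⟨0, hk⟩).2 (natAdd_mem_topMinusIdx _))

/-- Auxiliary (topPlusIdx ne topMinusIdx). [folklore] -/
private theorem topPlusIdx_ne_topMinusIdx (hk : 0 < k) : topPlusIdx k ≠ topMinusIdx k := fun h ↦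
  castAdd_not_mem_topMinusIdx (k := k) ⟨0, hk⟩ (h ▸ castAdd_mem_topPlusIdx _)

/-- The increasing enumeration of `castAdd(I) ∪ natAdd(I)` for `I = {i}` is `(castAdd i, natAdd i)`. [folklore] -/
private theorem orderEmbOfFin_pairedSet_singleton (i : Fin k) (h : (pairedSet ({i} : Finset (Fin k))).card = 2) :
    (fun r : Fin 2 => (Finset.orderEmbOfFin _ h r)) = ![Fin.castAdd k i, Fin.natAdd k i] := by
  have hmono : StrictMono (![Fin.castAdd k i, Fin.natAdd k i] : Fin 2 → Fin (k + k)) := by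
    rw [Fin.strictMono_iff_lt_succ]
    intro r
    fin_cases r
    change Fin.castAdd k i < Fin.natAdd k i
    rw [Fin.lt_def, Fin.val_castAdd, Fin.val_natAdd]
    omega
  have hmem : ∀ r, (OrderEmbedding.ofStrictMono _ hmono) r ∈ pairedSet ({i} : Finset (Fin k)) := by
    intro r
    fin_cases r
    · exact castAdd_mem_pairedSet.2 (Finset.mem_singleton_self i)
    · exact natAdd_mem_pairedSet.2 (Finset.mem_singleton_self i)
  have h2 := Finset.orderEmbOfFin_unique' h hmem
  funext r
  rw [← h2]
  rfl

/-- The increasing enumeration of the top set `{castAdd i}` is `castAdd`. [folklore] -/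
private theorem orderEmbOfFin_topPlusIdx (r : Fin k) :
    Finset.orderEmbOfFin (topPlusIdx k).val (topPlusIdx k).prop r = Fin.castAdd k r := by
  have h2 := Finset.orderEmbOfFin_unique' (topPlusIdx k).prop
    (f := OrderEmbedding.ofStrictMono _ (Fin.strictMono_castAdd k)) fun r ↦ castAdd_mem_topPlusIdx r
  rw [← h2]
  rfl

/-- The increasing enumeration of the top set `{natAdd j}` is `natAdd`. [folklore] -/
private theorem orderEmbOfFin_topMinusIdx (r : Fin k) :
    Finset.orderEmbOfFin (topMinusIdx k).val (topMinusIdx k).prop r = Fin.natAdd k r := by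
  have h2 := Finset.orderEmbOfFin_unique' (topMinusIdx k).prop
    (f := OrderEmbedding.ofStrictMono _ (Fin.strictMono_natAdd k)) fun r ↦ natAdd_mem_topMinusIdx r
  rw [← h2]
  rfl

end Special

/-! ### G. Generic cup-product lemmas -/

section CupLemmas

variable {Y : Type} [TopologicalSpace Y]

/-- Changing the target degree along an equation does not change the vanishing of a cup product. [folklore] -/
private theorem cupProduct_eq_zero_iff_of_eq {p q d₁ d₂ : ℕ} (h₁ : p + q = d₁) (h₂ : p + q = d₂)
    (x : singularCohomology ℂ ℂ Y p) (y : singularCohomology ℂ ℂ Y q) :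
    cupProduct h₁ x y = 0 ↔ cupProduct h₂ x y = 0 := by
  subst h₁; subst h₂; exact Iff.rfl

/-- `m₂(v) = v₀ ∪ v₁`. [folklore] -/
private theorem cupPowOne_two (v : Fin 2 → singularCohomology ℂ ℂ Y 1) :
    cupPowOne ℂ Y 2 v = cupProduct (rfl : 1 + 1 = 2) (v 0) (v 1) := by
  rw [cupPowOne_succ]
  exact congrArg _ (cupPowOne_one ℂ Y (Fin.tail v))

/-- `0^j = 0` in positive degree. [folklore] -/
private theorem cupPowTwo_zero_of_pos {j : ℕ} (hj : 0 < j) : cupPowTwo (0 : singularCohomology ℂ ℂ Y 2) j = 0 := by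
  obtain ⟨j, rfl⟩ := Nat.exists_eq_succ_of_ne_zero hj.ne'
  rw [cupPowTwo_succ, map_zero]

/-- If `x^p = 0` then `x^q = 0` for `q ≥ p`. [folklore] -/
private theorem cupPowTwo_eq_zero_of_le (x : singularCohomology ℂ ℂ Y 2) {p q : ℕ} (hpq : p ≤ q) (hp : cupPowTwo x p = 0) :
    cupPowTwo x q = 0 := by
  obtain ⟨r, rfl⟩ := Nat.exists_eq_add_of_le hpq
  induction r with
  | zero => exact hp
  | succ r ih =>
    rw [← Nat.add_assoc, cupPowTwo_succ, ih (Nat.le_add_right p r), LinearMap.map_zero₂]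

/-- `⋀•u` is compatible with powers of a degree-two class: if `⋀²u (x) = x` then `⋀^{2j}u (x^j) = x^j`.
[cite: vanGeemen1994HodgeAV, 6.5] -/
theorem extAct_cupPowTwo {A : AbelianVariety ℂ} (u : complexBetti A.X 1 →ₗ[ℂ] complexBetti A.X 1)
    {x : complexBetti A.X 2} (hx : extAct u 2 x = x) (j : ℕ) : extAct u (2 * j) (cupPowTwo x j) = cupPowTwo x j := by
  induction j with
  | zero => exact exteriorPullback_one (hasExteriorCohomologyH1 A) u
  | succ j ih =>
    rw [cupPowTwo_succ]
    change extAct u (2 * j + 2) _ = _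
    rw [extAct, exteriorPullback_cupProduct, ← extAct, ← extAct, ih, hx]

/-- `⋀¹u = u`. [folklore] -/
private theorem extAct_one_apply {A : AbelianVariety ℂ} (u : complexBetti A.X 1 →ₗ[ℂ] complexBetti A.X 1) (x : complexBetti A.X 1) :
    extAct u 1 x = u x := by
  have h := extAct_cupPowOne u 1 (fun _ => x)
  rwa [cupPowOne_one, cupPowOne_one] at h

/-- `n ≤ 2n`. [folklore] -/
private theorem le_two_mul_self (n : ℕ) : n ≤ 2 * n := by omega

end CupLemmas

/-! ### H. The Weil datum at `k = 2n`: bases, `h_K`, and the degree-two structure -/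

section Main

variable {A : AbelianVariety ℂ} {n d : ℕ} {φ : A ⟶ A}

/-- `h_K = d·e^*a + φ^*e^*a` (shorthand). [cite: vanGeemen1994HodgeAV, 5.2 (1) and 6.9] -/
abbrev hK (d : ℕ) (φ : A ⟶ A) (e : ProjectiveEmbedding A.X) (a : complexBetti (projectiveSpace e.n ℂ) 2) :
    complexBetti A.X 2 :=
  (d : ℂ) • complexBetti.map e.ι 2 a + complexBetti.map φ.hom.hom.hom 2 (complexBetti.map e.ι 2 a)

/-- Auxiliary (hm of). [folklore] -/
private theorem hm_of (hn : 2 ≤ n) : 1 ≤ 2 * n - 1 := by omega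

/-- Auxiliary (hA' of). [folklore] -/
private theorem hA'_of (hn : 2 ≤ n) (hA : A.dim = 2 * n) : A.dim = 2 * n - 1 + 1 := by omega

/-- `dim W = 2n`. [cite: vanGeemen1994HodgeAV, Lemma 6.10] -/
theorem finrank_eigW (hd : 0 < d) (hφ : φ ≫ φ = -(d • 𝟙 A)) (hA : A.dim = 2 * n) :
    Module.finrank ℂ (eigW A φ d) = 2 * n := by
  have h2 := two_mul_finrank_eigenspace_eq (A := A) hd hφ
  rw [abelianVarietyCohomologyExteriorH1_holds.finrank_one A, hA] at h2
  change 2 * Module.finrank ℂ (eigW A φ d) = _ at h2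
  omega

/-- A basis of `W` indexed by `Fin (2n)`. [cite: vanGeemen1994HodgeAV, proof of Thm. 6.12] -/
def wBasis (hd : 0 < d) (hφ : φ ≫ φ = -(d • 𝟙 A)) (hA : A.dim = 2 * n) : Module.Basis (Fin (2 * n)) ℂ (eigW A φ d) := by
  haveI := finite_complexBetti_abelianVariety A 1
  exact Module.finBasisOfFinrankEq ℂ _ (finrank_eigW hd hφ hA)

variable (hn : 2 ≤ n) (hd : 0 < d) (hA : A.dim = 2 * n) (hφ : φ ≫ φ = -(d • 𝟙 A))
  (e : ProjectiveEmbedding A.X) {a : complexBetti (projectiveSpace e.n ℂ) 2} (ha : IsRationalClass a) (ha0 : a ≠ 0)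

/-- The Weil basis of `H¹(A(ℂ); ℂ)` at `k = 2n`. [cite: vanGeemen1994HodgeAV, proof of Thm. 6.12] -/
abbrev bW : Module.Basis (Fin (2 * n + 2 * n)) ℂ (complexBetti A.X 1) :=
  weilBasis (hm_of hn) (hA'_of hn hA) hd hφ e ha ha0 (wBasis hd hφ hA)

/-- The pair index `{castAdd i, natAdd i}` in degree `2 = 2·1`. [cite: vanGeemen1994HodgeAV, proof of Thm. 6.12] -/
def pairIdx (i : Fin (2 * n)) : Set.powersetCard (Fin (2 * n + 2 * n)) (2 * 1) :=
  pairedIdx ({i} : Finset (Fin (2 * n))) (by rw [Finset.card_singleton])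

/-- Auxiliary (isPaired pairIdx). [folklore] -/
private theorem isPaired_pairIdx (i : Fin (2 * n)) : IsPaired (pairIdx i).val := isPaired_pairedSet _

/-- Auxiliary (projW pairIdx). [folklore] -/
private theorem projW_pairIdx (i : Fin (2 * n)) : projW (pairIdx i).val = {i} := projW_pairedSet _

/-- A paired index set of degree `2` is a pair index. [folklore] -/
private theorem eq_pairIdx_of_isPaired {s : Set.powersetCard (Fin (2 * n + 2 * n)) (2 * 1)} (hs : IsPaired s.val) :
    ∃ i, s = pairIdx i := by
  have hc := card_eq_two_mul_of_isPaired hs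
  rw [Set.powersetCard.card_eq] at hc
  obtain ⟨i, hi⟩ := Finset.card_eq_one.1 (by omega : (projW s.val).card = 1)
  exact ⟨i, Subtype.ext (eq_of_isPaired_of_projW_eq hs (isPaired_pairIdx i) (by rw [hi, projW_pairIdx]))⟩

/-- `eᵢ := wᵢ ∪ w^*ᵢ`, the pair monomial. [cite: vanGeemen1994HodgeAV, proof of Thm. 6.12] -/
theorem monB_pairIdx (i : Fin (2 * n)) :
    monB (bW hn hd hA hφ e ha ha0) (2 * 1) (pairIdx i) =
      cupProduct (rfl : 1 + 1 = 2) (bW hn hd hA hφ e ha ha0 (Fin.castAdd (2 * n) i))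
        (bW hn hd hA hφ e ha ha0 (Fin.natAdd (2 * n) i)) := by
  rw [monB_apply]
  change cupPowOne ℂ _ 2 (fun r : Fin 2 => bW hn hd hA hφ e ha ha0 (Finset.orderEmbOfFin _ (pairIdx i).prop r)) = _
  have h := orderEmbOfFin_pairedSet_singleton i (pairIdx (n := n) i).prop
  rw [show (fun r : Fin 2 => bW hn hd hA hφ e ha ha0 (Finset.orderEmbOfFin _ (pairIdx i).prop r)) =
      fun r : Fin 2 => bW hn hd hA hφ e ha ha0 (![Fin.castAdd (2 * n) i, Fin.natAdd (2 * n) i] r) from by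
    funext r; exact congrArg _ (congrFun h r)]
  rw [cupPowOne_two]
  rfl

/-- The polarization pairing on the Weil basis pairs: `Q(wᵢ, w^*ⱼ) = δᵢⱼ ω_A`, read through `eᵢ`.
[cite: vanGeemen1994HodgeAV, proof of Thm. 6.12] -/
theorem lefschetzPow_monB_pairIdx (i : Fin (2 * n)) :
    lefschetzPow (hK d φ e a) (2 * n - 1) 2 (monB (bW hn hd hA hφ e ha ha0) (2 * 1) (pairIdx i)) =
      topGen (hA'_of hn hA) := by
  rw [monB_pairIdx, ← polarizationPairingOne_apply, polarizationPairingOne_weilBasis_castAdd_natAdd, if_pos rfl, one_smul]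

/-! ### I. The `K`-symmetrised class in the monomial basis: `h_K = α · Σᵢ wᵢ ∪ w^*ᵢ` -/

include hn hd hA ha ha0 in
/-- `h_K ∈ B¹ ⊗ ℂ` (rational of type `(1,1)`). [cite: vanGeemen1994HodgeAV, Lemma 5.2 (1) and 2.1] -/
theorem hK_mem_hodgeClassSpan : hK d φ e a ∈ hodgeClassSpan A.dim A.X 1 := by
  refine Submodule.subset_span ⟨isRationalClass_ksymm d φ e ha, ?_⟩
  have h := isOfHodgeType_one_one_ksymm (hA'_of hn hA) hd φ e ha ha0
  rw [← hA'_of hn hA] at h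
  exact h

include hn hd hA ha ha0 in
/-- `h_Kᵖ ∈ Bᵖ ⊗ ℂ`. [cite: vanGeemen1994HodgeAV, 2.1 and 2.4] -/
theorem cupPowTwo_hK_mem_hodgeClassSpan (p : ℕ) : cupPowTwo (hK d φ e a) p ∈ hodgeClassSpan A.dim A.X p := by
  refine Submodule.subset_span ⟨(isRationalClass_ksymm d φ e ha).cupPowTwo p, ?_⟩
  have h := isOfHodgeType_one_one_ksymm (hA'_of hn hA) hd φ e ha ha0
  rw [← hA'_of hn hA] at h
  exact isOfHodgeType_cupPowTwo (isSmoothProjective_of_dim_eq' rfl) h p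

include hn hd hA ha ha0 in
/-- `h_Kᵖ` is a divisor monomial (`∈ Dᵖ`). [cite: vanGeemen1994HodgeAV, 2.4] -/
theorem cupPowTwo_hK_mem_divisorMonomials (p : ℕ) :
    cupPowTwo (hK d φ e a) p ∈ Literature.Barriers.HodgeConjecture.divisorMonomials A.X A.dim p := by
  have h11 := isOfHodgeType_one_one_ksymm (hA'_of hn hA) hd φ e ha ha0
  rw [← hA'_of hn hA] at h11
  induction p with
  | zero => rw [cupPowTwo_zero]; rfl
  | succ p ih =>
    exact ⟨_, ih, _, isRationalClass_ksymm d φ e ha, h11, by rw [cupPowTwo_succ]⟩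

variable (hW : ∀ c ∈ weilClassesOf A φ n d, IsOfHodgeType (2 * n) A.X (2 * n) n n c)
  (hSU : HasHodgeGroupSU A φ n d (hK d φ e a))

include hSU in
/-- Torus invariance of Hodge classes. [cite: vanGeemen1994HodgeAV, Thm. 6.6 and Thm. 6.12] -/
theorem extAct_torusAuto_of_mem {p : ℕ} {z : complexBetti A.X (2 * p)} (hz : z ∈ hodgeClassSpan A.dim A.X p)
    {i₀ i₁ : Fin (2 * n)} (hne : i₀ ≠ i₁) :
    extAct (torusAuto (hm_of hn) (hA'_of hn hA) hd hφ e ha ha0 (wBasis hd hφ hA) i₀ i₁ :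
      complexBetti A.X 1 →ₗ[ℂ] complexBetti A.X 1) (2 * p) z = z :=
  extAct_eq_self_of_mem_hodgeClassSpan hSU (torusAuto_mem _ _ hd hφ e ha ha0 _ n d rfl rfl hne) hz

include hSU in
/-- Signed-transposition invariance of Hodge classes. [cite: vanGeemen1994HodgeAV, Thm. 6.6 and Thm. 6.12] -/
theorem extAct_swapAuto_of_mem {p : ℕ} {z : complexBetti A.X (2 * p)} (hz : z ∈ hodgeClassSpan A.dim A.X p)
    {x y : Fin (2 * n)} (hxy : x ≠ y) :
    extAct (swapAuto (hm_of hn) (hA'_of hn hA) hd hφ e ha ha0 (wBasis hd hφ hA) x y :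
      complexBetti A.X 1 →ₗ[ℂ] complexBetti A.X 1) (2 * p) z = z :=
  extAct_eq_self_of_mem_hodgeClassSpan hSU (swapAuto_mem _ _ hd hφ e ha ha0 _ n d rfl rfl hxy) hz

/-- Auxiliary (not isTopPlus of ne). [folklore] -/
private theorem not_isTopPlus_of_ne {p : ℕ} (hpn : p ≠ n) (s : Set.powersetCard (Fin (2 * n + 2 * n)) (2 * p)) :
    ¬IsTopPlus s.val := fun h ↦ by
  have h1 := card_eq_of_isTopPlus h
  rw [Set.powersetCard.card_eq] at h1
  omega

/-- Auxiliary (not isTopMinus of ne). [folklore] -/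
private theorem not_isTopMinus_of_ne {p : ℕ} (hpn : p ≠ n) (s : Set.powersetCard (Fin (2 * n + 2 * n)) (2 * p)) :
    ¬IsTopMinus s.val := fun h ↦ by
  have h1 := card_eq_of_isTopMinus h
  rw [Set.powersetCard.card_eq] at h1
  omega

include hSU in
/-- **Uniqueness for Hodge classes off the middle degree**: a class of `Bᵖ ⊗ ℂ` (`p ≠ n`, `p ≤ 2n`) with
vanishing coordinate at the reference paired monomial is zero. [cite: vanGeemen1994HodgeAV, proof of Thm. 6.12] -/
theorem eq_zero_of_mem_hodgeClassSpan_of_ne {p : ℕ} (hp : p ≤ 2 * n) (hpn : p ≠ n)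
    {z : complexBetti A.X (2 * p)} (hz : z ∈ hodgeClassSpan A.dim A.X p)
    (h0 : (monB (bW hn hd hA hφ e ha ha0) (2 * p)).repr z (refIdx p hp) = 0) : z = 0 :=
  eq_zero_of_invariant (hm_of hn) (hA'_of hn hA) hd hφ e ha ha0 (wBasis hd hφ hA) z
    (fun _ _ hne ↦ extAct_torusAuto_of_mem hn hd hA hφ e ha ha0 hSU hz hne)
    (fun _ _ hxy ↦ extAct_swapAuto_of_mem hn hd hA hφ e ha ha0 hSU hz hxy)
    (refIdx p hp) (isPaired_refIdx p hp) h0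
    (fun s hs ↦ hs.elim (fun h ↦ absurd h (not_isTopPlus_of_ne hpn s))
      fun h ↦ absurd h (not_isTopMinus_of_ne hpn s))

include hSU in
/-- **Uniqueness for Hodge classes in the middle degree**: vanishing coordinates at the reference paired
monomial and at the two top monomials force zero. [cite: vanGeemen1994HodgeAV, proof of Thm. 6.12] -/
theorem eq_zero_of_mem_hodgeClassSpan_mid {z : complexBetti A.X (2 * n)} (hz : z ∈ hodgeClassSpan A.dim A.X n)
    (h0 : (monB (bW hn hd hA hφ e ha ha0) (2 * n)).repr z (refIdx n (le_two_mul_self n)) = 0)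
    (h1 : (monB (bW hn hd hA hφ e ha ha0) (2 * n)).repr z (topPlusIdx (2 * n)) = 0)
    (h2 : (monB (bW hn hd hA hφ e ha ha0) (2 * n)).repr z (topMinusIdx (2 * n)) = 0) : z = 0 :=
  eq_zero_of_invariant (hm_of hn) (hA'_of hn hA) hd hφ e ha ha0 (wBasis hd hφ hA) z
    (fun _ _ hne ↦ extAct_torusAuto_of_mem hn hd hA hφ e ha ha0 hSU hz hne)
    (fun _ _ hxy ↦ extAct_swapAuto_of_mem hn hd hA hφ e ha ha0 hSU hz hxy)
    (refIdx n (le_two_mul_self n)) (isPaired_refIdx n _) h0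
    (fun s hs ↦ hs.elim (fun h ↦ by rw [eq_topPlusIdx_of_isTopPlus h]; exact h1)
      fun h ↦ by rw [eq_topMinusIdx_of_isTopMinus h]; exact h2)

include hn hSU in
/-- The non-paired coordinates of `h_K` vanish. [cite: vanGeemen1994HodgeAV, proof of Thm. 6.12] -/
theorem repr_hK_eq_zero_of_not_isPaired (s : Set.powersetCard (Fin (2 * n + 2 * n)) (2 * 1)) (hs : ¬IsPaired s.val) :
    (monB (bW hn hd hA hφ e ha ha0) (2 * 1)).repr (hK d φ e a) s = 0 :=
  repr_eq_zero_of_not_isPaired (hm_of hn) (hA'_of hn hA) hd hφ e ha ha0 (wBasis hd hφ hA) (hK d φ e a)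
    (fun _ _ hne ↦ extAct_torusAuto_of_mem hn hd hA hφ e ha ha0 hSU (hK_mem_hodgeClassSpan hn hd hA e ha ha0) hne)
    s hs (not_isTopPlus_of_ne (by omega) s) (not_isTopMinus_of_ne (by omega) s)

/-- The signed transposition maps `e_x` to `e_y`. [cite: vanGeemen1994HodgeAV, proof of Thm. 6.12] -/
theorem extAct_swapAuto_monB_pairIdx {x y : Fin (2 * n)} (hxy : x ≠ y) :
    extAct (swapAuto (hm_of hn) (hA'_of hn hA) hd hφ e ha ha0 (wBasis hd hφ hA) x y :
      complexBetti A.X 1 →ₗ[ℂ] complexBetti A.X 1) (2 * 1) (monB (bW hn hd hA hφ e ha ha0) (2 * 1) (pairIdx x)) =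
      monB (bW hn hd hA hφ e ha ha0) (2 * 1) (pairIdx y) := by
  rw [monB_pairIdx, monB_pairIdx]
  set u := (swapAuto (hm_of hn) (hA'_of hn hA) hd hφ e ha ha0 (wBasis hd hφ hA) x y :
      complexBetti A.X 1 →ₗ[ℂ] complexBetti A.X 1) with hu
  have hmul := exteriorPullback_cupProduct (hasExteriorCohomologyH1 A) u (rfl : 1 + 1 = 2)
    (bW hn hd hA hφ e ha ha0 (Fin.castAdd (2 * n) x)) (bW hn hd hA hφ e ha ha0 (Fin.natAdd (2 * n) x))
  change exteriorPullback (hasExteriorCohomologyH1 A) u 2 _ = _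
  rw [hmul]
  change cupProduct rfl (extAct u 1 _) (extAct u 1 _) = _
  rw [extAct_one_apply, extAct_one_apply, hu, LinearEquiv.coe_coe, swapAuto, monoAuto_weilBasis, monoAuto_weilBasis,
    blockPerm_castAdd, blockPerm_natAdd, Equiv.swap_apply_left, swapUnits_castAdd, swapUnits_natAdd,
    Function.update_of_ne hxy.symm, Units.val_one, one_smul, one_smul]

/-- `permSet (swap ⊕ swap) {x-pair} = {y-pair}`. [folklore] -/
private theorem permSet_swap_pairIdx {x y : Fin (2 * n)} :
    permSet (blockPerm (Equiv.swap x y)) (pairIdx (n := n) x) = pairIdx y := by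
  have hP := isPaired_map_blockPerm (isPaired_pairIdx (n := n) x) (Equiv.swap x y)
  refine Subtype.ext (eq_of_isPaired_of_projW_eq hP.1 (isPaired_pairIdx y) ?_)
  change projW ((pairIdx x).val.map _) = _
  rw [hP.2, projW_pairIdx, projW_pairIdx, Finset.map_singleton]
  simp

include hSU in
/-- **All pair coordinates of `h_K` agree.** [cite: vanGeemen1994HodgeAV, proof of Thm. 6.12] -/
theorem repr_hK_pairIdx_eq (x y : Fin (2 * n)) :
    (monB (bW hn hd hA hφ e ha ha0) (2 * 1)).repr (hK d φ e a) (pairIdx y) =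
      (monB (bW hn hd hA hφ e ha ha0) (2 * 1)).repr (hK d φ e a) (pairIdx x) := by
  classical
  by_cases hxy : x = y
  · rw [hxy]
  set B := monB (bW hn hd hA hφ e ha ha0) (2 * 1) with hB
  choose ε _ hε using extAct_swapAuto_monB (hm_of hn) (hA'_of hn hA) hd hφ e ha ha0 (wBasis hd hφ hA) x y (2 * 1)
  have h := repr_apply_of_monomial B _ (permSetEquiv (blockPerm (Equiv.swap x y)) (2 * 1)) ε hε (hK d φ e a) (pairIdx x)
  rw [extAct_swapAuto_of_mem hn hd hA hφ e ha ha0 hSU (hK_mem_hodgeClassSpan hn hd hA e ha ha0) hxy] at h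
  change B.repr (hK d φ e a) (permSet (blockPerm (Equiv.swap x y)) (pairIdx x)) = _ at h
  rw [permSet_swap_pairIdx] at h
  -- `ε (pairIdx x) = 1`
  have hε1 : ε (pairIdx x) = 1 := by
    have h1 := hε (pairIdx x)
    rw [extAct_swapAuto_monB_pairIdx hn hd hA hφ e ha ha0 hxy, permSet_swap_pairIdx] at h1
    have h2 : (ε (pairIdx x) - 1) • B (pairIdx y) = 0 := by rw [sub_smul, one_smul, ← h1, sub_self]
    exact sub_eq_zero.1 ((smul_eq_zero.1 h2).resolve_right (B.ne_zero _))
  rw [h, hε1, one_mul]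

/-- Auxiliary (pairIdx injective). [folklore] -/
private theorem pairIdx_injective : Function.Injective (pairIdx (n := n)) := fun i j h ↦ by
  have h1 := congrArg (fun s : Set.powersetCard (Fin (2 * n + 2 * n)) (2 * 1) => projW s.val) h
  simp only [projW_pairIdx, Finset.singleton_inj] at h1
  exact h1

/-- `F₁ := Σᵢ wᵢ ∪ w^*ᵢ` (van Geemen's `E`, up to a scalar). [cite: vanGeemen1994HodgeAV, proof of Thm. 6.12] -/
def F1 : complexBetti A.X (2 * 1) := ∑ i, monB (bW hn hd hA hφ e ha ha0) (2 * 1) (pairIdx i)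

include hSU in
/-- **`h_K = α · Σᵢ wᵢ ∪ w^*ᵢ`** with `α` the common pair coordinate. [cite: vanGeemen1994HodgeAV, proof of Thm. 6.12] -/
theorem hK_eq_smul_F1 :
    hK d φ e a = (monB (bW hn hd hA hφ e ha ha0) (2 * 1)).repr (hK d φ e a) (pairIdx ⟨0, by omega⟩) •
      F1 hn hd hA hφ e ha ha0 := by
  classical
  set B := monB (bW hn hd hA hφ e ha ha0) (2 * 1) with hB
  set α := B.repr (hK d φ e a) (pairIdx ⟨0, by omega⟩) with hα
  refine B.ext_elem fun s ↦ ?_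
  rw [F1, map_smul, map_sum, Finsupp.smul_apply, Finset.sum_apply']
  simp_rw [← hB, B.repr_self]
  by_cases hs : IsPaired s.val
  · obtain ⟨j, rfl⟩ := eq_pairIdx_of_isPaired hs
    rw [repr_hK_pairIdx_eq hn hd hA hφ e ha ha0 hSU ⟨0, by omega⟩ j, ← hα, Finset.sum_eq_single j]
    · rw [Finsupp.single_eq_same, smul_eq_mul, mul_one]
    · intro i _ hij
      exact Finsupp.single_eq_of_ne (fun h ↦ hij (pairIdx_injective h.symm))
    · intro h; exact absurd (Finset.mem_univ j) h
  · rw [repr_hK_eq_zero_of_not_isPaired hn hd hA hφ e ha ha0 hSU s hs, Finset.sum_eq_zero, smul_zero]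
    intro i _
    exact Finsupp.single_eq_of_ne fun h ↦ hs (h ▸ isPaired_pairIdx i)

/-! ### J. Non-vanishing of the powers `h_K^p`, `p ≤ 2n`, and the top coordinates of `h_K^n` -/

/-- The common pair coordinate `α` of `h_K`. [cite: vanGeemen1994HodgeAV, proof of Thm. 6.12] -/
abbrev alphaK : ℂ := (monB (bW hn hd hA hφ e ha ha0) (2 * 1)).repr (hK d φ e a) (pairIdx ⟨0, by omega⟩)

include hSU in
/-- **`L_{h_K}^{2n-1} h_K = (α · 2n) ω_A`**: the Lefschetz iterate of `h_K = α Σ eᵢ` is the sum of the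
`2n` values `Q(wᵢ, w^*ᵢ) = ω_A`. [cite: vanGeemen1994HodgeAV, proof of Thm. 6.12] -/
theorem lefschetzPow_hK_hK :
    lefschetzPow (hK d φ e a) (2 * n - 1) 2 (hK d φ e a) =
      (alphaK hn hd hA hφ e ha ha0 * (2 * n : ℕ)) • topGen (hA'_of hn hA) := by
  nth_rw 2 [hK_eq_smul_F1 hn hd hA hφ e ha ha0 hSU]
  rw [map_smul, F1, map_sum]
  simp_rw [lefschetzPow_monB_pairIdx]
  rw [Finset.sum_const, Finset.card_univ, Fintype.card_fin, ← Nat.cast_smul_eq_nsmul ℂ, smul_smul]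

include hSU in
/-- `α ≠ 0` (`h_K ≠ 0`: `Q_{h_K}(w₁, w^*₁) = ω_A ≠ 0`). [cite: vanGeemen1994HodgeAV, proof of Thm. 6.12] -/
theorem alphaK_ne_zero : alphaK hn hd hA hφ e ha ha0 ≠ 0 := by
  intro h0
  have hK0 : hK d φ e a = 0 := by
    rw [hK_eq_smul_F1 hn hd hA hφ e ha ha0 hSU]
    change alphaK hn hd hA hφ e ha ha0 • _ = 0
    rw [h0, zero_smul]
  have h1 := lefschetzPow_monB_pairIdx hn hd hA hφ e ha ha0 ⟨0, by omega⟩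
  rw [HodgeRiemannDegreeOne.lefschetzPow_eq_cupPowTwo_cupProduct] at h1
  have h2 : cupPowTwo (hK d φ e a) (2 * n - 1) = 0 := by
    rw [hK0]; exact cupPowTwo_zero_of_pos (by omega)
  rw [h2, LinearMap.map_zero₂] at h1
  exact topGen_ne_zero _ h1.symm

include hn hd hA hφ ha ha0 hSU in
/-- **`h_K^{2n} ≠ 0`** (as `h_K^{(2n-1)+1}`): `h_K^{2n-1} ∪ h_K` has the same vanishing as
`L^{2n-1}_{h_K} h_K = 2nα · ω_A ≠ 0`. [cite: vanGeemen1994HodgeAV, proof of Thm. 6.12] -/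
theorem cupPowTwo_hK_succ_ne_zero : cupPowTwo (hK d φ e a) (2 * n - 1 + 1) ≠ 0 := by
  intro h0
  rw [cupPowTwo_succ] at h0
  have h1 := lefschetzPow_hK_hK hn hd hA hφ e ha ha0 hSU
  rw [HodgeRiemannDegreeOne.lefschetzPow_eq_cupPowTwo_cupProduct] at h1
  rw [cupProduct_eq_zero_iff_of_eq (two_mul_add_two (2 * n - 1)) (by omega : 2 * (2 * n - 1) + 2 = 2 + 2 * (2 * n - 1))]
    at h0
  rw [h0] at h1
  have hc : alphaK hn hd hA hφ e ha ha0 * (2 * n : ℕ) ≠ 0 :=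
    mul_ne_zero (alphaK_ne_zero hn hd hA hφ e ha ha0 hSU) (by exact_mod_cast (by omega : 2 * n ≠ 0))
  exact hc (smul_eq_zero.1 h1.symm |>.resolve_right (topGen_ne_zero _))

include hn hd hA hφ ha ha0 hSU in
/-- **`h_K^p ≠ 0` for `p ≤ 2n`.** [cite: vanGeemen1994HodgeAV, proof of Thm. 6.12 and 6.5 (`E^n ≠ 0`)] -/
theorem cupPowTwo_hK_ne_zero {p : ℕ} (hp : p ≤ 2 * n) : cupPowTwo (hK d φ e a) p ≠ 0 := fun h0 ↦
  cupPowTwo_hK_succ_ne_zero hn hd hA hφ e ha ha0 hSU (cupPowTwo_eq_zero_of_le _ (by omega) h0)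

/-- The scaling units: `2` on `w_{i₀}`, `1/2` on `w^*_{i₀}`, `1` elsewhere (an element of `U_H(ℂ)`, NOT of
`SU_H(ℂ)`; used only through its exterior action). [folklore] -/
private def scaleUnits (i₀ : Fin (2 * n)) : Fin (2 * n + 2 * n) → ℂˣ :=
  Fin.append (Function.update (fun _ => (1 : ℂˣ)) i₀ two') (fun i => (Function.update (fun _ => (1 : ℂˣ)) i₀ two' i)⁻¹)

/-- Auxiliary (scaleUnits castAdd). [folklore] -/
private theorem scaleUnits_castAdd (i₀ i : Fin (2 * n)) :
    scaleUnits i₀ (Fin.castAdd (2 * n) i) = Function.update (fun _ => (1 : ℂˣ)) i₀ two' i := by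
  rw [scaleUnits, Fin.append_left]

/-- Auxiliary (scaleUnits natAdd). [folklore] -/
private theorem scaleUnits_natAdd (i₀ i : Fin (2 * n)) :
    scaleUnits i₀ (Fin.natAdd (2 * n) i) = (Function.update (fun _ => (1 : ℂˣ)) i₀ two' i)⁻¹ := by
  rw [scaleUnits, Fin.append_right]

/-- The scaling automorphism of `H¹(A(ℂ); ℂ)`. [folklore] -/
private def scaleAuto (i₀ : Fin (2 * n)) : complexBetti A.X 1 ≃ₗ[ℂ] complexBetti A.X 1 :=
  monoAuto (hm_of hn) (hA'_of hn hA) hd hφ e ha ha0 (wBasis hd hφ hA) 1 (scaleUnits i₀)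

/-- Auxiliary (scaleAuto weilBasis). [folklore] -/
private theorem scaleAuto_weilBasis (i₀ : Fin (2 * n)) (q : Fin (2 * n + 2 * n)) :
    scaleAuto hn hd hA hφ e ha ha0 i₀ (bW hn hd hA hφ e ha ha0 q) = (scaleUnits i₀ q : ℂ) • bW hn hd hA hφ e ha ha0 q := by
  rw [scaleAuto, monoAuto_weilBasis, blockPerm_one, Equiv.Perm.one_apply]

/-- The scaling weight of an index set. [folklore] -/
private def scaleWeight (i₀ : Fin (2 * n)) (t : Finset (Fin (2 * n + 2 * n))) : ℂ := ∏ j ∈ t, (scaleUnits i₀ j : ℂ)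

/-- Auxiliary (extAct scaleAuto monB). [folklore] -/
private theorem extAct_scaleAuto_monB (i₀ : Fin (2 * n)) (q : ℕ) (t : Set.powersetCard (Fin (2 * n + 2 * n)) q) :
    extAct (scaleAuto hn hd hA hφ e ha ha0 i₀ : complexBetti A.X 1 →ₗ[ℂ] complexBetti A.X 1) q
      (monB (bW hn hd hA hφ e ha ha0) q t) = scaleWeight i₀ t.val • monB (bW hn hd hA hφ e ha ha0) q t :=
  extAct_monB_of_diagonal _ _ _ (fun q ↦ by rw [LinearEquiv.coe_coe, scaleAuto_weilBasis]) q t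

/-- The scaling weight of a pair monomial is `1`. [folklore] -/
private theorem scaleWeight_pairIdx (i₀ i : Fin (2 * n)) : scaleWeight i₀ (pairIdx i).val = 1 := by
  classical
  change ∏ j ∈ pairedSet ({i} : Finset (Fin (2 * n))), (scaleUnits i₀ j : ℂ) = 1
  rw [pairedSet, Finset.map_singleton, Finset.map_singleton]
  change ∏ j ∈ ({Fin.castAdd (2 * n) i} ∪ {Fin.natAdd (2 * n) i} : Finset (Fin (2 * n + 2 * n))),
    (scaleUnits i₀ j : ℂ) = 1
  rw [Finset.prod_union (Finset.disjoint_singleton.2 (castAdd_ne_natAdd i i)), Finset.prod_singleton,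
    Finset.prod_singleton, scaleUnits_castAdd, scaleUnits_natAdd, Units.val_inv_eq_inv_val,
    mul_inv_cancel₀ (Units.ne_zero _)]

/-- Auxiliary (prod update two'). [folklore] -/
private theorem prod_update_two' (i₀ : Fin (2 * n)) :
    ∏ i, ((Function.update (fun _ => (1 : ℂˣ)) i₀ two' i : ℂˣ) : ℂ) = 2 := by
  classical
  rw [Finset.prod_eq_single i₀]
  · rw [Function.update_self, coe_two']
  · intro b _ hb; rw [Function.update_of_ne hb, Units.val_one]
  · intro h; exact absurd (Finset.mem_univ _) h

/-- The scaling weight of the top monomial `w₁ ∧ ⋯ ∧ w_{2n}` is `2`. [folklore] -/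
private theorem scaleWeight_topPlusIdx (i₀ : Fin (2 * n)) : scaleWeight i₀ (topPlusIdx (2 * n)).val = 2 := by
  classical
  change ∏ j ∈ (Finset.univ : Finset (Fin (2 * n))).map (Fin.castAddEmb (2 * n)), (scaleUnits i₀ j : ℂ) = 2
  rw [Finset.prod_map]
  change ∏ i, (scaleUnits i₀ (Fin.castAdd (2 * n) i) : ℂ) = 2
  simp_rw [scaleUnits_castAdd]
  exact prod_update_two' i₀

/-- The scaling weight of the top monomial `w^*₁ ∧ ⋯ ∧ w^*_{2n}` is `1/2`. [folklore] -/
private theorem scaleWeight_topMinusIdx (i₀ : Fin (2 * n)) : scaleWeight i₀ (topMinusIdx (2 * n)).val = 2⁻¹ := by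
  classical
  change ∏ j ∈ (Finset.univ : Finset (Fin (2 * n))).map (Fin.natAddEmb (2 * n)), (scaleUnits i₀ j : ℂ) = 2⁻¹
  rw [Finset.prod_map]
  change ∏ i, (scaleUnits i₀ (Fin.natAdd (2 * n) i) : ℂ) = 2⁻¹
  simp_rw [scaleUnits_natAdd, Units.val_inv_eq_inv_val]
  rw [Finset.prod_inv_distrib, prod_update_two']

include hSU in
/-- The scaling automorphism fixes `h_K` (it fixes every `eᵢ = wᵢ ∪ w^*ᵢ`). [folklore] -/
private theorem extAct_scaleAuto_hK (i₀ : Fin (2 * n)) :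
    extAct (scaleAuto hn hd hA hφ e ha ha0 i₀ : complexBetti A.X 1 →ₗ[ℂ] complexBetti A.X 1) 2 (hK d φ e a) =
      hK d φ e a := by
  conv_lhs => rw [hK_eq_smul_F1 hn hd hA hφ e ha ha0 hSU]
  conv_rhs => rw [hK_eq_smul_F1 hn hd hA hφ e ha ha0 hSU]
  change extAct _ (2 * 1) _ = _
  rw [map_smul, F1, map_sum]
  simp_rw [extAct_scaleAuto_monB, scaleWeight_pairIdx, one_smul]

include hSU in
/-- **The top coordinates of `h_K^n` vanish** (apply the scaling automorphism: weight `2` resp. `1/2` on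
the tops, weight `1` on `h_K^n`). [cite: vanGeemen1994HodgeAV, proof of Thm. 6.12] -/
theorem repr_cupPowTwo_hK_topPlusIdx :
    (monB (bW hn hd hA hφ e ha ha0) (2 * n)).repr (cupPowTwo (hK d φ e a) n) (topPlusIdx (2 * n)) = 0 := by
  classical
  set B := monB (bW hn hd hA hφ e ha ha0) (2 * n) with hB
  have i₀ : Fin (2 * n) := ⟨0, by omega⟩
  have hfix := extAct_cupPowTwo _ (extAct_scaleAuto_hK hn hd hA hφ e ha ha0 hSU i₀) n
  have h := repr_apply_of_monomial B _ 1 (fun t ↦ scaleWeight i₀ t.val)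
    (fun t ↦ by rw [Equiv.Perm.one_apply]; exact extAct_scaleAuto_monB hn hd hA hφ e ha ha0 i₀ (2 * n) t)
    (cupPowTwo (hK d φ e a) n) (topPlusIdx (2 * n))
  rw [Equiv.Perm.one_apply, hfix, scaleWeight_topPlusIdx] at h
  have h' : B.repr (cupPowTwo (hK d φ e a) n) (topPlusIdx (2 * n)) * (2 - 1) = 0 := by
    rw [mul_sub, mul_one, mul_comm, ← h, sub_self]
  exact (mul_eq_zero.1 h').resolve_right (by norm_num)

include hSU in
/-- The `T₋`-coordinate of `h_Kⁿ` vanishes. [cite: vanGeemen1994HodgeAV, proof of Thm. 6.12] -/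
theorem repr_cupPowTwo_hK_topMinusIdx :
    (monB (bW hn hd hA hφ e ha ha0) (2 * n)).repr (cupPowTwo (hK d φ e a) n) (topMinusIdx (2 * n)) = 0 := by
  classical
  set B := monB (bW hn hd hA hφ e ha ha0) (2 * n) with hB
  have i₀ : Fin (2 * n) := ⟨0, by omega⟩
  have hfix := extAct_cupPowTwo _ (extAct_scaleAuto_hK hn hd hA hφ e ha ha0 hSU i₀) n
  have h := repr_apply_of_monomial B _ 1 (fun t ↦ scaleWeight i₀ t.val)
    (fun t ↦ by rw [Equiv.Perm.one_apply]; exact extAct_scaleAuto_monB hn hd hA hφ e ha ha0 i₀ (2 * n) t)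
    (cupPowTwo (hK d φ e a) n) (topMinusIdx (2 * n))
  rw [Equiv.Perm.one_apply, hfix, scaleWeight_topMinusIdx] at h
  have h' : B.repr (cupPowTwo (hK d φ e a) n) (topMinusIdx (2 * n)) * (2⁻¹ - 1) = 0 := by
    rw [mul_sub, mul_one, mul_comm, ← h, sub_self]
  exact (mul_eq_zero.1 h').resolve_right (by norm_num)

/-! ### K. The two top monomials span the Weil plane; the Hodge ring -/

/-- `T₊ := w₁ ∪ ⋯ ∪ w_{2n}`. [cite: vanGeemen1994HodgeAV, proof of Thm. 6.12 ("`∧^{2n}W`")] -/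
abbrev TP : complexBetti A.X (2 * n) := monB (bW hn hd hA hφ e ha ha0) (2 * n) (topPlusIdx (2 * n))

/-- `T₋ := w^*₁ ∪ ⋯ ∪ w^*_{2n}`. [cite: vanGeemen1994HodgeAV, proof of Thm. 6.12 ("`∧^{2n}W^*`")] -/
abbrev TM : complexBetti A.X (2 * n) := monB (bW hn hd hA hφ e ha ha0) (2 * n) (topMinusIdx (2 * n))

/-- `T₊ ∈ E₊ = ⋀^{2n}W`. [cite: vanGeemen1994HodgeAV, proof of Thm. 6.12] -/
theorem TP_mem_weilClassesPlus : TP hn hd hA hφ e ha ha0 ∈ weilClassesPlus A φ n d := by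
  rw [TP, monB_apply]
  simp_rw [orderEmbOfFin_topPlusIdx]
  refine mem_weilClassesPlus_iff.2 fun x y ↦ ?_
  change complexBetti.map (x • 𝟙 A + y • φ).hom.hom.hom (2 * n) _ = _
  have hv : ∀ r : Fin (2 * n), bW hn hd hA hφ e ha ha0 (Fin.castAdd (2 * n) r) ∈
      Module.End.eigenspace (complexBetti.map φ.hom.hom.hom 1).hom (Complex.I * (Real.sqrt d : ℂ)) := fun r ↦ by
    rw [weilBasis_castAdd]; exact (wBasis hd hφ hA r).2
  rw [map_cupPowOne_of_mem_eigenspace hv x y, mul_assoc]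

/-- `T₋ ∈ E₋ = ⋀^{2n}W^*`. [cite: vanGeemen1994HodgeAV, proof of Thm. 6.12] -/
theorem TM_mem_weilClassesMinus : TM hn hd hA hφ e ha ha0 ∈ weilClassesMinus A φ n d := by
  rw [TM, monB_apply]
  simp_rw [orderEmbOfFin_topMinusIdx]
  refine mem_weilClassesMinus_iff.2 fun x y ↦ ?_
  change complexBetti.map (x • 𝟙 A + y • φ).hom.hom.hom (2 * n) _ = _
  have hv : ∀ r : Fin (2 * n), bW hn hd hA hφ e ha ha0 (Fin.natAdd (2 * n) r) ∈
      Module.End.eigenspace (complexBetti.map φ.hom.hom.hom 1).hom (-(Complex.I * (Real.sqrt d : ℂ))) := fun r ↦ by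
    rw [weilBasis_natAdd]; exact (dualBasisWbar _ _ hd hφ e ha ha0 (wBasis hd hφ hA) r).2
  rw [map_cupPowOne_of_mem_eigenspace hv x y, mul_neg, ← sub_eq_add_neg, mul_assoc]

include hA in
/-- Auxiliary (finrank H1). [folklore] -/
private theorem finrank_H1 : Module.finrank ℂ (complexBetti A.X 1) = 2 * (2 * n) := by
  rw [abelianVarietyCohomologyExteriorH1_holds.finrank_one A, hA]

/-- **The Weil plane is spanned by the two top monomials.** [cite: vanGeemen1994HodgeAV, proof of Thm. 6.12] -/
theorem weilClassesOf_eq_sup :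
    weilClassesOf A φ n d = (ℂ ∙ TP hn hd hA hφ e ha ha0) ⊔ (ℂ ∙ TM hn hd hA hφ e ha ha0) := by
  apply le_antisymm
  · exact sup_le_sup
      (weilClassesPlus_le_span_singleton (hasExteriorCohomologyH1 A) (finrank_H1 hA) hd hφ
        (TP_mem_weilClassesPlus hn hd hA hφ e ha ha0) (Module.Basis.ne_zero _ _))
      (weilClassesMinus_le_span_singleton (hasExteriorCohomologyH1 A) (finrank_H1 hA) hd hφ
        (TM_mem_weilClassesMinus hn hd hA hφ e ha ha0) (Module.Basis.ne_zero _ _))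
  · exact sup_le_sup ((Submodule.span_singleton_le_iff_mem _ _).2 (TP_mem_weilClassesPlus hn hd hA hφ e ha ha0))
      ((Submodule.span_singleton_le_iff_mem _ _).2 (TM_mem_weilClassesMinus hn hd hA hφ e ha ha0))

include hn hd hA hφ hW in
/-- Under the Weil-type hypothesis the Weil plane consists of Hodge classes. [cite: vanGeemen1994HodgeAV, 4.10 and Lemma 5.2 (6)] -/
theorem weilClassesOf_le_hodgeClassSpan : weilClassesOf A φ n d ≤ hodgeClassSpan A.dim A.X n := by
  rw [weilClassesOf_eq_span_isRationalClass (by omega) hA hd hφ]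
  refine Submodule.span_mono fun c hc ↦ ⟨hc.1, ?_⟩
  rw [hA]
  exact hW c hc.2

include hn hd hA hφ ha ha0 hSU in
/-- **`Bᵖ ⊗ ℂ = ℂ · h_K^p` for `p ≤ 2n`, `p ≠ n`.** [cite: vanGeemen1994HodgeAV, Thm. 6.12 and Thm. 4.11] -/
theorem hodgeClassSpan_eq_span_cupPowTwo {p : ℕ} (hp : p ≤ 2 * n) (hpn : p ≠ n) :
    hodgeClassSpan A.dim A.X p = ℂ ∙ cupPowTwo (hK d φ e a) p := by
  classical
  set B := monB (bW hn hd hA hφ e ha ha0) (2 * p) with hB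
  set hp' := cupPowTwo (hK d φ e a) p with hhp
  have hmem : hp' ∈ hodgeClassSpan A.dim A.X p := cupPowTwo_hK_mem_hodgeClassSpan hn hd hA e ha ha0 p
  apply le_antisymm
  · intro x hx
    -- `c_h • x - c_x • h^p` has vanishing reference coordinate
    set ch := B.repr hp' (refIdx p hp) with hch
    set cx := B.repr x (refIdx p hp) with hcx
    have hz : ch • x - cx • hp' = 0 :=
      eq_zero_of_mem_hodgeClassSpan_of_ne hn hd hA hφ e ha ha0 hSU hp hpn
        (Submodule.sub_mem _ (Submodule.smul_mem _ _ hx) (Submodule.smul_mem _ _ hmem))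
        (by rw [map_sub, map_smul, map_smul, Finsupp.sub_apply, Finsupp.smul_apply, Finsupp.smul_apply, ← hch, ← hcx,
          smul_eq_mul, smul_eq_mul, mul_comm, sub_self])
    have hch0 : ch ≠ 0 := fun h0 ↦ cupPowTwo_hK_ne_zero hn hd hA hφ e ha ha0 hSU hp
      (eq_zero_of_mem_hodgeClassSpan_of_ne hn hd hA hφ e ha ha0 hSU hp hpn hmem (by rw [← hch, h0]))
    rw [Submodule.mem_span_singleton]
    refine ⟨ch⁻¹ * cx, ?_⟩
    rw [sub_eq_zero] at hz
    rw [mul_smul, ← hz, smul_smul, inv_mul_cancel₀ hch0, one_smul]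
  · exact (Submodule.span_singleton_le_iff_mem _ _).2 hmem

include hSU in
/-- Auxiliary (repr cupPowTwo refIdx ne zero). [folklore] -/
private theorem repr_cupPowTwo_refIdx_ne_zero :
    (monB (bW hn hd hA hφ e ha ha0) (2 * n)).repr (cupPowTwo (hK d φ e a) n) (refIdx n (le_two_mul_self n)) ≠ 0 := fun h0 ↦
  cupPowTwo_hK_ne_zero hn hd hA hφ e ha ha0 hSU (by omega : n ≤ 2 * n)
    (eq_zero_of_mem_hodgeClassSpan_mid hn hd hA hφ e ha ha0 hSU (cupPowTwo_hK_mem_hodgeClassSpan hn hd hA e ha ha0 n) h0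
      (repr_cupPowTwo_hK_topPlusIdx hn hd hA hφ e ha ha0 hSU) (repr_cupPowTwo_hK_topMinusIdx hn hd hA hφ e ha ha0 hSU))

/-- Auxiliary (refIdx ne topPlusIdx). [folklore] -/
private theorem refIdx_ne_topPlusIdx : (refIdx n (le_two_mul_self n) : Set.powersetCard (Fin (2 * n + 2 * n)) (2 * n)) ≠ topPlusIdx (2 * n) ∨ n = 0 := by
  by_cases hn0 : n = 0
  · exact Or.inr hn0
  · refine Or.inl fun h ↦ not_isPaired_topPlusIdx (k := 2 * n) (by omega) ?_
    rw [← h]; exact isPaired_refIdx n _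

/-- Auxiliary (refIdx ne topMinusIdx). [folklore] -/
private theorem refIdx_ne_topMinusIdx : (refIdx n (le_two_mul_self n) : Set.powersetCard (Fin (2 * n + 2 * n)) (2 * n)) ≠ topMinusIdx (2 * n) ∨ n = 0 := by
  by_cases hn0 : n = 0
  · exact Or.inr hn0
  · refine Or.inl fun h ↦ not_isPaired_topMinusIdx (k := 2 * n) (by omega) ?_
    rw [← h]; exact isPaired_refIdx n _

include hW hSU in
/-- **`Bⁿ ⊗ ℂ = ℂ h_Kⁿ + ℂ T₊ + ℂ T₋`**: every middle Hodge class is a combination of `h_Kⁿ` and the two top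
monomials. [cite: vanGeemen1994HodgeAV, Thm. 6.12] -/
theorem exists_repr_of_mem_hodgeClassSpan_mid {x : complexBetti A.X (2 * n)} (hx : x ∈ hodgeClassSpan A.dim A.X n) :
    ∃ r b c : ℂ, x = r • cupPowTwo (hK d φ e a) n + b • TP hn hd hA hφ e ha ha0 + c • TM hn hd hA hφ e ha ha0 := by
  classical
  set B := monB (bW hn hd hA hφ e ha ha0) (2 * n) with hB
  set hp' := cupPowTwo (hK d φ e a) n with hhp
  set s₀ : Set.powersetCard (Fin (2 * n + 2 * n)) (2 * n) := refIdx n (le_two_mul_self n) with hs₀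
  have hmem : hp' ∈ hodgeClassSpan A.dim A.X n := cupPowTwo_hK_mem_hodgeClassSpan hn hd hA e ha ha0 n
  have hWle := weilClassesOf_le_hodgeClassSpan hn hd hA hφ hW
  have hTP : TP hn hd hA hφ e ha ha0 ∈ hodgeClassSpan A.dim A.X n :=
    hWle (weilClassesPlus_le_weilClassesOf A φ n d (TP_mem_weilClassesPlus hn hd hA hφ e ha ha0))
  have hTM : TM hn hd hA hφ e ha ha0 ∈ hodgeClassSpan A.dim A.X n :=
    hWle (weilClassesMinus_le_weilClassesOf A φ n d (TM_mem_weilClassesMinus hn hd hA hφ e ha ha0))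
  set ch := B.repr hp' s₀ with hch
  have hch0 : ch ≠ 0 := repr_cupPowTwo_refIdx_ne_zero hn hd hA hφ e ha ha0 hSU
  have hn0 : n ≠ 0 := by omega
  have hne1 : s₀ ≠ topPlusIdx (2 * n) := (refIdx_ne_topPlusIdx (n := n)).resolve_right hn0
  have hne2 : s₀ ≠ topMinusIdx (2 * n) := (refIdx_ne_topMinusIdx (n := n)).resolve_right hn0
  have hne3 : topPlusIdx (2 * n) ≠ topMinusIdx (2 * n) := topPlusIdx_ne_topMinusIdx (by omega)
  -- coordinates of the three generators
  have hTPs : B.repr (TP hn hd hA hφ e ha ha0) s₀ = 0 := by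
    rw [TP, ← hB, B.repr_self, Finsupp.single_eq_of_ne hne1]
  have hTMs : B.repr (TM hn hd hA hφ e ha ha0) s₀ = 0 := by
    rw [TM, ← hB, B.repr_self, Finsupp.single_eq_of_ne hne2]
  have hTPP : B.repr (TP hn hd hA hφ e ha ha0) (topPlusIdx (2 * n)) = 1 := by
    rw [TP, ← hB, B.repr_self, Finsupp.single_eq_same]
  have hTMM : B.repr (TM hn hd hA hφ e ha ha0) (topMinusIdx (2 * n)) = 1 := by
    rw [TM, ← hB, B.repr_self, Finsupp.single_eq_same]
  have hTPM : B.repr (TP hn hd hA hφ e ha ha0) (topMinusIdx (2 * n)) = 0 := by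
    rw [TP, ← hB, B.repr_self, Finsupp.single_eq_of_ne hne3.symm]
  have hTMP : B.repr (TM hn hd hA hφ e ha ha0) (topPlusIdx (2 * n)) = 0 := by
    rw [TM, ← hB, B.repr_self, Finsupp.single_eq_of_ne hne3]
  have hhP : B.repr hp' (topPlusIdx (2 * n)) = 0 := repr_cupPowTwo_hK_topPlusIdx hn hd hA hφ e ha ha0 hSU
  have hhM : B.repr hp' (topMinusIdx (2 * n)) = 0 := repr_cupPowTwo_hK_topMinusIdx hn hd hA hφ e ha ha0 hSU
  set r := ch⁻¹ * B.repr x s₀ with hr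
  set b := B.repr x (topPlusIdx (2 * n)) with hb
  set c := B.repr x (topMinusIdx (2 * n)) with hc
  refine ⟨r, b, c, ?_⟩
  have hz : x - (r • hp' + b • TP hn hd hA hφ e ha ha0 + c • TM hn hd hA hφ e ha ha0) = 0 := by
    refine eq_zero_of_mem_hodgeClassSpan_mid hn hd hA hφ e ha ha0 hSU
      (Submodule.sub_mem _ hx (Submodule.add_mem _ (Submodule.add_mem _ (Submodule.smul_mem _ _ hmem)
        (Submodule.smul_mem _ _ hTP)) (Submodule.smul_mem _ _ hTM))) ?_ ?_ ?_
    · simp only [map_sub, map_add, map_smul, Finsupp.sub_apply, Finsupp.add_apply, Finsupp.smul_apply, smul_eq_mul]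
      rw [← hs₀, hTPs, hTMs, ← hch, mul_zero, mul_zero, add_zero, add_zero, hr, mul_comm ch⁻¹, mul_assoc,
        inv_mul_cancel₀ hch0, mul_one]
      exact sub_self _
    · simp only [map_sub, map_add, map_smul, Finsupp.sub_apply, Finsupp.add_apply, Finsupp.smul_apply, smul_eq_mul]
      rw [hhP, hTPP, hTMP, ← hb, mul_zero, mul_one, mul_zero, zero_add, add_zero, sub_self]
    · simp only [map_sub, map_add, map_smul, Finsupp.sub_apply, Finsupp.add_apply, Finsupp.smul_apply, smul_eq_mul]
      rw [hhM, hTPM, hTMM, ← hc, mul_zero, mul_zero, mul_one, zero_add, zero_add, sub_self]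
  rw [sub_eq_zero] at hz
  exact hz

include hSU in
/-- `h_Kⁿ, T₊, T₋` are linearly independent. [cite: vanGeemen1994HodgeAV, Thm. 6.12] -/
theorem eq_zero_of_combination_eq_zero {r b c : ℂ}
    (h : r • cupPowTwo (hK d φ e a) n + b • TP hn hd hA hφ e ha ha0 + c • TM hn hd hA hφ e ha ha0 = 0) :
    r = 0 ∧ b = 0 ∧ c = 0 := by
  classical
  set B := monB (bW hn hd hA hφ e ha ha0) (2 * n) with hB
  have hne3 : topPlusIdx (2 * n) ≠ topMinusIdx (2 * n) := topPlusIdx_ne_topMinusIdx (by omega)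
  have hhP : B.repr (cupPowTwo (hK d φ e a) n) (topPlusIdx (2 * n)) = 0 :=
    repr_cupPowTwo_hK_topPlusIdx hn hd hA hφ e ha ha0 hSU
  have hhM : B.repr (cupPowTwo (hK d φ e a) n) (topMinusIdx (2 * n)) = 0 :=
    repr_cupPowTwo_hK_topMinusIdx hn hd hA hφ e ha ha0 hSU
  have h1 := congrArg (fun z ↦ B.repr z (topPlusIdx (2 * n))) h
  have h2 := congrArg (fun z ↦ B.repr z (topMinusIdx (2 * n))) h
  simp only [map_add, map_smul, Finsupp.add_apply, Finsupp.smul_apply, smul_eq_mul, map_zero, Finsupp.zero_apply] at h1 h2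
  rw [hhP, TP, TM, ← hB, B.repr_self, B.repr_self, Finsupp.single_eq_same, Finsupp.single_eq_of_ne hne3] at h1
  rw [hhM, TP, TM, ← hB, B.repr_self, B.repr_self, Finsupp.single_eq_same, Finsupp.single_eq_of_ne hne3.symm] at h2
  simp only [mul_zero, mul_one, zero_add, add_zero] at h1 h2
  subst h1; subst h2
  rw [zero_smul, zero_smul, add_zero, add_zero] at h
  exact ⟨(smul_eq_zero.1 h).resolve_right (cupPowTwo_hK_ne_zero hn hd hA hφ e ha ha0 hSU (by omega)), rfl, rfl⟩

include hn hd hA hφ ha ha0 hSU in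
/-- **`Dᵖ ⊗ ℂ ⊆ ℂ · h_Kᵖ`** (every rational `(1,1)`-class is a multiple of `h_K`, as `B¹ ⊗ ℂ = ℂ h_K` for
`n ≥ 2`). [cite: vanGeemen1994HodgeAV, Thm. 4.11 ("`B¹(X) = ℚ` and thus `Dᵖ(X) = ℚ`")] -/
theorem divisorMonomials_subset_span (p : ℕ) :
    Literature.Barriers.HodgeConjecture.divisorMonomials A.X A.dim p ⊆ (ℂ ∙ cupPowTwo (hK d φ e a) p : Submodule ℂ _) := by
  induction p with
  | zero =>
    intro c hc
    rw [Literature.Barriers.HodgeConjecture.mem_divisorMonomials_zero] at hc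
    rw [hc, cupPowTwo_zero]
    exact Submodule.mem_span_singleton_self _
  | succ p ih =>
    rintro c ⟨a', ha', b', hb'1, hb'2, rfl⟩
    obtain ⟨s, hs⟩ := Submodule.mem_span_singleton.1 (ih ha')
    have hb' : b' ∈ hodgeClassSpan A.dim A.X 1 := Submodule.subset_span ⟨hb'1, hb'2⟩
    rw [hodgeClassSpan_eq_span_cupPowTwo hn hd hA hφ e ha ha0 hSU (p := 1) (by omega) (by omega), cupPowTwo_one] at hb'
    obtain ⟨t, ht⟩ := Submodule.mem_span_singleton.1 hb'
    rw [← hs, ← ht, LinearMap.map_smul₂, map_smul, ← cupPowTwo_succ, smul_smul]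
    exact Submodule.smul_mem _ _ (Submodule.mem_span_singleton_self _)

include hn hd hA hφ ha ha0 hSU in
/-- `Dᵖ ⊗ ℂ = ℂ · h_Kᵖ`. [cite: vanGeemen1994HodgeAV, Thm. 4.11 and §2.4] -/
theorem divisorClassesSpan_eq_span (p : ℕ) :
    Literature.Barriers.HodgeConjecture.divisorClassesSpan A.X A.dim p = ℂ ∙ cupPowTwo (hK d φ e a) p := by
  apply le_antisymm
  · exact Submodule.span_le.2 (divisorMonomials_subset_span hn hd hA hφ e ha ha0 hSU p)
  · exact (Submodule.span_singleton_le_iff_mem _ _).2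
      (Submodule.subset_span (cupPowTwo_hK_mem_divisorMonomials hn hd hA e ha ha0 p))

/-! ### L. Theorem 6.12, corrected statement (`n ≥ 2`), proved -/

/-- **Van Geemen 1994, Theorem 6.12 (Weil 1977) — CORRECTED STATEMENT (`n ≥ 2`).** The tree's named fact
`VanGeemen1994_thm612` quantifies over `0 < n`; for `n = 1` its last conjunct
`Disjoint (D¹ ⊗ ℂ) (W_K ⊗ ℂ)` contradicts its own hypotheses (for an abelian SURFACE `D¹ = B¹ ⊇ W_K ≠ 0`),
and van Geemen's Thm. 4.11 — of which 6.12 is the refined form — carries the printed proviso "(with `n > 1`)".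
This is the same statement with `2 ≤ n`: for `A` of dimension `2n`, `φ ≫ φ = -d` (`d ≥ 1`), Weil classes
of Hodge type `(n,n)`, a `K`-symmetrised hyperplane class `h = d·e^*a + φ^*e^*a` (`a` rational, `≠ 0`) and
`Hg = SU_H` on `H¹` (`HasHodgeGroupSU`): (i) `dim_ℂ Bᵖ ⊗ ℂ = 1` for `p ≤ 2n`, `p ≠ n`; (ii) `dim_ℂ Bⁿ ⊗ ℂ = 3`;
(iii) `Bᵖ ⊗ ℂ = Dᵖ ⊗ ℂ` for `p ≠ n`; (iv) `Bⁿ ⊗ ℂ = Dⁿ ⊗ ℂ ⊔ W_K ⊗ ℂ`, the summands disjoint.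
[cite: vanGeemen1994HodgeAV, Thm. 6.12 and its proof, Thm. 4.11 ("with n > 1"), 2.4] [cite: Weil1977HodgeRing] -/
def VanGeemen1994_thm612_corrected : Prop :=
  ∀ (A : AbelianVariety ℂ) (φ : A ⟶ A) (n d : ℕ) (e : ProjectiveEmbedding A.X)
    (a : complexBetti (projectiveSpace e.n ℂ) 2),
    2 ≤ n → 0 < d → A.dim = 2 * n → φ ≫ φ = -(d • 𝟙 A) →
    (∀ c ∈ weilClassesOf A φ n d, IsOfHodgeType (2 * n) A.X (2 * n) n n c) →
    IsRationalClass a → a ≠ 0 →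
    HasHodgeGroupSU A φ n d
      ((d : ℂ) • complexBetti.map e.ι 2 a + complexBetti.map φ.hom.hom.hom 2 (complexBetti.map e.ι 2 a)) →
    (∀ p : ℕ, p ≤ 2 * n → p ≠ n → Module.finrank ℂ (hodgeClassSpan A.dim A.X p) = 1) ∧
      Module.finrank ℂ (hodgeClassSpan A.dim A.X n) = 3 ∧
      (∀ p : ℕ, p ≠ n → hodgeClassSpan A.dim A.X p =
        Literature.Barriers.HodgeConjecture.divisorClassesSpan A.X A.dim p) ∧
      hodgeClassSpan A.dim A.X n =
        Literature.Barriers.HodgeConjecture.divisorClassesSpan A.X A.dim n ⊔ weilClassesOf A φ n d ∧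
      Disjoint (Literature.Barriers.HodgeConjecture.divisorClassesSpan A.X A.dim n) (weilClassesOf A φ n d)

/-- **Theorem 6.12 (corrected, `n ≥ 2`) holds** — the first-fundamental-theorem half of Weil's theorem,
proved on the carriers by the torus / signed-transposition analysis of `⋀•(W ⊕ W^*)` under `SL(W) ⊆ SU_H(ℂ)`
(van Geemen, proof of Thm. 6.12), with `Hg` acting on `H• = ⋀•H¹` through `H¹`
(`HodgeTheory.hodgeGroup_apply_cupPowOne`). [cite: vanGeemen1994HodgeAV, Thm. 6.12 and its proof] -/
theorem VanGeemen1994_thm612_corrected_holds : VanGeemen1994_thm612_corrected := by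
  intro A φ n d e a hn hd hA hφ hW ha ha0 hSU
  classical
  haveI : ∀ k, Module.Finite ℂ (complexBetti A.X k) := fun k ↦ finite_complexBetti_abelianVariety A k
  have hpow := fun p (hp : p ≤ 2 * n) ↦ cupPowTwo_hK_ne_zero hn hd hA hφ e ha ha0 hSU hp
  refine ⟨fun p hp hpn ↦ ?_, ?_, fun p hpn ↦ ?_, ?_, ?_⟩
  · -- (i)
    rw [hodgeClassSpan_eq_span_cupPowTwo hn hd hA hφ e ha ha0 hSU hp hpn]
    exact finrank_span_singleton (hpow p hp)
  · -- (ii): `Bⁿ ⊗ ℂ` is spanned by the independent family `(h_Kⁿ, T₊, T₋)`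
    set v : Fin 3 → complexBetti A.X (2 * n) :=
      ![cupPowTwo (hK d φ e a) n, TP hn hd hA hφ e ha ha0, TM hn hd hA hφ e ha ha0] with hv
    have hli : LinearIndependent ℂ v := by
      rw [Fintype.linearIndependent_iff]
      intro g hg
      rw [Fin.sum_univ_three] at hg
      have h := eq_zero_of_combination_eq_zero hn hd hA hφ e ha ha0 hSU (r := g 0) (b := g 1) (c := g 2) hg
      intro i
      fin_cases i
      · exact h.1
      · exact h.2.1
      · exact h.2.2
    have hspan : hodgeClassSpan A.dim A.X n = Submodule.span ℂ (Set.range v) := by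
      apply le_antisymm
      · intro x hx
        obtain ⟨r, b, c, rfl⟩ := exists_repr_of_mem_hodgeClassSpan_mid hn hd hA hφ e ha ha0 hW hSU hx
        refine Submodule.add_mem _ (Submodule.add_mem _ ?_ ?_) ?_
        · exact Submodule.smul_mem _ _ (Submodule.subset_span ⟨0, rfl⟩)
        · exact Submodule.smul_mem _ _ (Submodule.subset_span ⟨1, rfl⟩)
        · exact Submodule.smul_mem _ _ (Submodule.subset_span ⟨2, rfl⟩)
      · rw [Submodule.span_le]
        rintro _ ⟨i, rfl⟩
        have hWle := weilClassesOf_le_hodgeClassSpan hn hd hA hφ hW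
        fin_cases i
        · exact cupPowTwo_hK_mem_hodgeClassSpan hn hd hA e ha ha0 n
        · exact hWle (weilClassesPlus_le_weilClassesOf A φ n d (TP_mem_weilClassesPlus hn hd hA hφ e ha ha0))
        · exact hWle (weilClassesMinus_le_weilClassesOf A φ n d (TM_mem_weilClassesMinus hn hd hA hφ e ha ha0))
    rw [hspan, finrank_span_eq_card hli, Fintype.card_fin]
  · -- (iii)
    by_cases hp : p ≤ 2 * n
    · rw [hodgeClassSpan_eq_span_cupPowTwo hn hd hA hφ e ha ha0 hSU hp hpn,
        divisorClassesSpan_eq_span hn hd hA hφ e ha ha0 hSU]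
    · haveI : Subsingleton (complexBetti A.X (2 * p)) :=
        abelianVarietyCohomologyExteriorH1_holds.subsingleton_of_lt A (by omega)
      apply le_antisymm <;> intro x _ <;> rw [Subsingleton.elim x 0] <;> exact Submodule.zero_mem _
  · -- (iv)
    rw [divisorClassesSpan_eq_span hn hd hA hφ e ha ha0 hSU, weilClassesOf_eq_sup hn hd hA hφ e ha ha0]
    apply le_antisymm
    · intro x hx
      obtain ⟨r, b, c, rfl⟩ := exists_repr_of_mem_hodgeClassSpan_mid hn hd hA hφ e ha ha0 hW hSU hx
      refine Submodule.add_mem _ (Submodule.add_mem _ ?_ ?_) ?_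
      · exact Submodule.mem_sup_left (Submodule.smul_mem _ _ (Submodule.mem_span_singleton_self _))
      · exact Submodule.mem_sup_right (Submodule.mem_sup_left (Submodule.smul_mem _ _ (Submodule.mem_span_singleton_self _)))
      · exact Submodule.mem_sup_right (Submodule.mem_sup_right (Submodule.smul_mem _ _ (Submodule.mem_span_singleton_self _)))
    · have hWle := weilClassesOf_le_hodgeClassSpan hn hd hA hφ hW
      rw [← weilClassesOf_eq_sup hn hd hA hφ e ha ha0]
      exact sup_le ((Submodule.span_singleton_le_iff_mem _ _).2 (cupPowTwo_hK_mem_hodgeClassSpan hn hd hA e ha ha0 n)) hWle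
  · -- disjointness
    rw [divisorClassesSpan_eq_span hn hd hA hφ e ha ha0 hSU, weilClassesOf_eq_sup hn hd hA hφ e ha ha0,
      Submodule.disjoint_def]
    intro x hx1 hx2
    obtain ⟨r, rfl⟩ := Submodule.mem_span_singleton.1 hx1
    obtain ⟨y, hy, z, hz, hyz⟩ := Submodule.mem_sup.1 hx2
    obtain ⟨b, rfl⟩ := Submodule.mem_span_singleton.1 hy
    obtain ⟨c, rfl⟩ := Submodule.mem_span_singleton.1 hz
    have h0 : r • cupPowTwo (hK d φ e a) n + (-b) • TP hn hd hA hφ e ha ha0 + (-c) • TM hn hd hA hφ e ha ha0 = 0 := by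
      rw [neg_smul, neg_smul, ← hyz]; abel
    have h := eq_zero_of_combination_eq_zero hn hd hA hφ e ha ha0 hSU h0
    rw [h.1, zero_smul]

end Main

/-! ### M. Corollaries, unconditional for `n ≥ 2` (the consumers' shapes of `VanGeemen1994_thm612`) -/

section Corollaries

variable {A : AbelianVariety ℂ} {φ : A ⟶ A} {n d : ℕ}

/-- **Corollary (the Hodge ring is generated by divisors and the Weil plane), unconditional for `n ≥ 2`.**
Under the hypotheses of Theorem 6.12 with `2 ≤ n`, every rational `(p,p)`-class with `p ≠ n` lies in
`Dᵖ ⊗ ℂ`, and every rational `(n,n)`-class lies in `Dⁿ ⊗ ℂ + W_K ⊗ ℂ` — the shape of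
`VanGeemen1994_thm612.divisorWeilGenerated` without the fact hypothesis.
[cite: vanGeemen1994HodgeAV, Thm. 4.11 and Thm. 6.12] -/
theorem divisorWeilGenerated_of_hasHodgeGroupSU (e : ProjectiveEmbedding A.X)
    {a : complexBetti (projectiveSpace e.n ℂ) 2} (hn : 2 ≤ n) (hd : 0 < d) (hA : A.dim = 2 * n)
    (hφ : φ ≫ φ = -(d • 𝟙 A))
    (hW : ∀ c ∈ weilClassesOf A φ n d, IsOfHodgeType (2 * n) A.X (2 * n) n n c)
    (ha : IsRationalClass a) (ha0 : a ≠ 0)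
    (hSU : HasHodgeGroupSU A φ n d
      ((d : ℂ) • complexBetti.map e.ι 2 a + complexBetti.map φ.hom.hom.hom 2 (complexBetti.map e.ι 2 a))) :
    (∀ (p : ℕ) (c : complexBetti A.X (2 * p)), p ≠ n → IsRationalClass c →
        IsOfHodgeType A.dim A.X (2 * p) p p c →
          c ∈ Literature.Barriers.HodgeConjecture.divisorClassesSpan A.X A.dim p) ∧
      ∀ c : complexBetti A.X (2 * n), IsRationalClass c → IsOfHodgeType A.dim A.X (2 * n) n n c →
        c ∈ Literature.Barriers.HodgeConjecture.divisorClassesSpan A.X A.dim n ⊔ weilClassesOf A φ n d := by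
  obtain ⟨-, -, hBD, hBn, -⟩ := VanGeemen1994_thm612_corrected_holds A φ n d e a hn hd hA hφ hW ha ha0 hSU
  refine ⟨fun p c hp hc hpp ↦ ?_, fun c hc hpp ↦ ?_⟩
  · rw [← hBD p hp]
    exact Submodule.subset_span ⟨hc, hpp⟩
  · rw [← hBn]
    exact Submodule.subset_span ⟨hc, hpp⟩

/-- **`dim (Dⁿ ⊗ ℂ) + dim (W_K ⊗ ℂ) = 3`, unconditional for `n ≥ 2`** (so `Dⁿ ⊗ ℂ` is the line `ℂ·h_Kⁿ`,
Thm. 4.11's `Dⁿ = ℚ · Eⁿ`, since `dim W_K ⊗ ℂ = 2`). [cite: vanGeemen1994HodgeAV, Thm. 6.12 and Thm. 4.11] -/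
theorem finrank_divisor_add_finrank_weil_of_hasHodgeGroupSU (e : ProjectiveEmbedding A.X)
    {a : complexBetti (projectiveSpace e.n ℂ) 2} (hn : 2 ≤ n) (hd : 0 < d) (hA : A.dim = 2 * n)
    (hφ : φ ≫ φ = -(d • 𝟙 A))
    (hW : ∀ c ∈ weilClassesOf A φ n d, IsOfHodgeType (2 * n) A.X (2 * n) n n c)
    (ha : IsRationalClass a) (ha0 : a ≠ 0)
    (hSU : HasHodgeGroupSU A φ n d
      ((d : ℂ) • complexBetti.map e.ι 2 a + complexBetti.map φ.hom.hom.hom 2 (complexBetti.map e.ι 2 a))) :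
    Module.finrank ℂ (Literature.Barriers.HodgeConjecture.divisorClassesSpan A.X A.dim n) +
        Module.finrank ℂ (weilClassesOf A φ n d) = 3 := by
  haveI : Module.Finite ℂ (complexBetti A.X (2 * n)) := finite_complexBetti_abelianVariety A _
  obtain ⟨-, h3, -, hBn, hdisj⟩ := VanGeemen1994_thm612_corrected_holds A φ n d e a hn hd hA hφ hW ha ha0 hSU
  rw [← Submodule.finrank_sup_add_finrank_inf_eq, hdisj.eq_bot, finrank_bot, add_zero, ← hBn, h3]

/-- **`Dᵖ ⊗ ℂ` is a line for every `p ≤ 2n`** under the hypotheses of Theorem 6.12 with `2 ≤ n`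
(`Dᵖ = ℚ · Eᵖ`, Thm. 4.11). [cite: vanGeemen1994HodgeAV, Thm. 4.11] -/
theorem finrank_divisorClassesSpan_eq_one_of_hasHodgeGroupSU (e : ProjectiveEmbedding A.X)
    {a : complexBetti (projectiveSpace e.n ℂ) 2} (hn : 2 ≤ n) (hd : 0 < d) (hA : A.dim = 2 * n)
    (hφ : φ ≫ φ = -(d • 𝟙 A)) (ha : IsRationalClass a) (ha0 : a ≠ 0)
    (hSU : HasHodgeGroupSU A φ n d
      ((d : ℂ) • complexBetti.map e.ι 2 a + complexBetti.map φ.hom.hom.hom 2 (complexBetti.map e.ι 2 a)))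
    {p : ℕ} (hp : p ≤ 2 * n) :
    Module.finrank ℂ (Literature.Barriers.HodgeConjecture.divisorClassesSpan A.X A.dim p) = 1 := by
  rw [divisorClassesSpan_eq_span hn hd hA hφ e ha ha0 hSU]
  exact finrank_span_singleton (cupPowTwo_hK_ne_zero hn hd hA hφ e ha ha0 hSU hp)

end Corollaries

/-! ### N. The Hodge conjecture for the general Weil-type member reduces to its Weil classes (`n ≥ 2`) -/

section HodgeConjecture

variable {A : AbelianVariety ℂ} {φ : A ⟶ A} {n d : ℕ}

/-- **HC for an abelian variety of Weil type with `Hg = SU_H` (`n ≥ 2`) follows from the algebraicity of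
its own rational `(n,n)` Weil classes** — unconditionally in the kernel: `Bᵖ ⊗ ℂ = Dᵖ ⊗ ℂ` (`p ≠ n`) and
`Bⁿ ⊗ ℂ = Dⁿ ⊗ ℂ ⊔ W_K ⊗ ℂ` by Theorem 6.12 (`divisorWeilGenerated_of_hasHodgeGroupSU`), divisor
monomials are algebraic by Lefschetz `(1,1)` (`lefschetzOneOne_rational_holds`,
`AbelianVariety.divisorClassesSpan_le_algebraicClasses`), the Weil plane is spanned by its rational
classes (`weilClassesOf_eq_span_isRationalClass`). Van Geemen: "if `Dᵖ = Bᵖ`, then the Hodge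
`(p,p)`-conjecture is true" (§2.4) and "the abelian varieties of Weil-type provide an interesting test
case" (5.1; Thm. 4.11). [cite: vanGeemen1994HodgeAV, 2.4, Thm. 4.11 and Thm. 6.12] -/
theorem hodgeConjectureFor_of_hasHodgeGroupSU_of_weilClasses (e : ProjectiveEmbedding A.X)
    {a : complexBetti (projectiveSpace e.n ℂ) 2} (hn : 2 ≤ n) (hd : 0 < d) (hA : A.dim = 2 * n)
    (hφ : φ ≫ φ = -(d • 𝟙 A))
    (hW : ∀ c ∈ weilClassesOf A φ n d, IsOfHodgeType (2 * n) A.X (2 * n) n n c)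
    (ha : IsRationalClass a) (ha0 : a ≠ 0)
    (hSU : HasHodgeGroupSU A φ n d
      ((d : ℂ) • complexBetti.map e.ι 2 a + complexBetti.map φ.hom.hom.hom 2 (complexBetti.map e.ι 2 a)))
    (hR : ∀ c : complexBetti A.X (2 * n), IsRationalClass c → IsOfHodgeType (2 * n) A.X (2 * n) n n c →
      c ∈ weilClassesOf A φ n d → c ∈ algebraicClasses A.X n) :
    HodgeConjectureFor A.dim A.X := by
  obtain ⟨hBD, hBn⟩ := divisorWeilGenerated_of_hasHodgeGroupSU e hn hd hA hφ hW ha ha0 hSU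
  have h11 : ∀ b : complexBetti A.X (2 * 1), IsRationalClass b → IsOfHodgeType A.dim A.X (2 * 1) 1 1 b →
      b ∈ algebraicClasses A.X 1 :=
    fun b hb hb' ↦ lefschetzOneOne_rational_holds (AbelianVariety.isSmoothProjective_holds (A := A)) b hb hb'
  have hD : ∀ p, Literature.Barriers.HodgeConjecture.divisorClassesSpan A.X A.dim p ≤ algebraicClasses A.X p :=
    AbelianVariety.divisorClassesSpan_le_algebraicClasses A h11
  have hWalg : weilClassesOf A φ n d ≤ algebraicClasses A.X n := by
    rw [weilClassesOf_eq_span_isRationalClass (by omega) hA hd hφ, Submodule.span_le]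
    rintro c ⟨hcQ, hcW⟩
    exact hR c hcQ (hW c hcW) hcW
  refine ⟨nonempty_hodgeModel_holds (AbelianVariety.isSmoothProjective_holds (A := A)), fun p c hc hH ↦ ?_⟩
  by_cases hp : p = n
  · subst hp
    exact sup_le (hD p) hWalg (hBn c hc hH)
  · exact hD p (hBD p c hp hc hH)

/-- **Exactness on the slice (`n ≥ 2`)**: for a Weil-type abelian variety with `Hg = SU_H`, the Hodge conjecture
for `A` is EQUIVALENT to the algebraicity of its rational `(n,n)` Weil classes.
[cite: vanGeemen1994HodgeAV, Thm. 4.11 and Thm. 6.12] -/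
theorem hodgeConjectureFor_iff_weilClasses_of_hasHodgeGroupSU (e : ProjectiveEmbedding A.X)
    {a : complexBetti (projectiveSpace e.n ℂ) 2} (hn : 2 ≤ n) (hd : 0 < d) (hA : A.dim = 2 * n)
    (hφ : φ ≫ φ = -(d • 𝟙 A))
    (hW : ∀ c ∈ weilClassesOf A φ n d, IsOfHodgeType (2 * n) A.X (2 * n) n n c)
    (ha : IsRationalClass a) (ha0 : a ≠ 0)
    (hSU : HasHodgeGroupSU A φ n d
      ((d : ℂ) • complexBetti.map e.ι 2 a + complexBetti.map φ.hom.hom.hom 2 (complexBetti.map e.ι 2 a))) :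
    HodgeConjectureFor A.dim A.X ↔
      ∀ c : complexBetti A.X (2 * n), IsRationalClass c → IsOfHodgeType (2 * n) A.X (2 * n) n n c →
        c ∈ weilClassesOf A φ n d → c ∈ algebraicClasses A.X n := by
  refine ⟨fun hHC c hc hH _ ↦ ?_,
    fun hR ↦ hodgeConjectureFor_of_hasHodgeGroupSU_of_weilClasses e hn hd hA hφ hW ha ha0 hSU hR⟩
  have h2 := hHC.2 n c hc
  rw [hA] at h2
  exact h2 hH

end HodgeConjecture

/-! ### O. Bridges to the cell's predicates `HodgeTheory.IsDivisorWeilGenerated` / `HodgeTheory.IsWeilType` -/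

section Bridges

variable {A : AbelianVariety ℂ} {φ : A ⟶ A} {n d : ℕ}

/-- **`Hg = SU_H` ⟹ `IsDivisorWeilGenerated A φ n d` (`n ≥ 2`)**: the conclusion of Theorem 6.12 in the
form of the tree's predicate `HodgeTheory.IsDivisorWeilGenerated` (`Bᵖ ⊗ ℂ ⊆ Dᵖ ⊗ ℂ` for `p ≠ n`,
`Bⁿ ⊗ ℂ ⊆ Dⁿ ⊗ ℂ + W_K ⊗ ℂ`), unconditionally. [cite: vanGeemen1994HodgeAV, Thm. 6.12] -/
theorem isDivisorWeilGenerated_of_hasHodgeGroupSU (e : ProjectiveEmbedding A.X)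
    {a : complexBetti (projectiveSpace e.n ℂ) 2} (hn : 2 ≤ n) (hd : 0 < d) (hA : A.dim = 2 * n)
    (hφ : φ ≫ φ = -(d • 𝟙 A))
    (hW : ∀ c ∈ weilClassesOf A φ n d, IsOfHodgeType (2 * n) A.X (2 * n) n n c)
    (ha : IsRationalClass a) (ha0 : a ≠ 0)
    (hSU : HasHodgeGroupSU A φ n d
      ((d : ℂ) • complexBetti.map e.ι 2 a + complexBetti.map φ.hom.hom.hom 2 (complexBetti.map e.ι 2 a))) :
    HodgeTheory.IsDivisorWeilGenerated A φ n d :=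
  divisorWeilGenerated_of_hasHodgeGroupSU e hn hd hA hφ hW ha ha0 hSU

/-- **Theorem 6.12 for a Weil-type pair `HodgeTheory.IsWeilType A φ n d` with `n ≥ 2` and `Hg = SU_H`**:
the Weil-type hypothesis on the plane is supplied by van Geemen 4.10 / Lemma 5.2 (3)
(`IsWeilType.isOfHodgeType_of_mem_weilClassesOf`). [cite: vanGeemen1994HodgeAV, Thm. 6.12, 4.9–4.10] -/
theorem _root_.Literature.AlgebraicGeometry.HodgeTheory.IsWeilType.isDivisorWeilGenerated_of_hasHodgeGroupSU
    (h : HodgeTheory.IsWeilType A φ n d) (hn : 2 ≤ n) (e : ProjectiveEmbedding A.X)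
    {a : complexBetti (projectiveSpace e.n ℂ) 2} (ha : IsRationalClass a) (ha0 : a ≠ 0)
    (hSU : HasHodgeGroupSU A φ n d
      ((d : ℂ) • complexBetti.map e.ι 2 a + complexBetti.map φ.hom.hom.hom 2 (complexBetti.map e.ι 2 a))) :
    HodgeTheory.IsDivisorWeilGenerated A φ n d :=
  Literature.AlgebraicGeometry.VanGeemen1994.isDivisorWeilGenerated_of_hasHodgeGroupSU e hn h.d_pos
    h.dim_eq h.sq_eq (fun _ hc ↦ h.isOfHodgeType_of_mem_weilClassesOf hc) ha ha0 hSU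

/-- **HC for a Weil-type pair with `n ≥ 2` and `Hg = SU_H` ⟺ its rational `(n,n)` Weil classes are
algebraic** (`IsWeilType` form; `→` by `HodgeTheory.weilClasses_algebraic_of_hodgeConjectureFor`, `←` by
`HodgeTheory.hodgeConjectureFor_of_isDivisorWeilGenerated` with the divisor ring algebraic by Lefschetz
`(1,1)`). [cite: vanGeemen1994HodgeAV, Thm. 4.11, 2.4 and Thm. 6.12] -/
theorem _root_.Literature.AlgebraicGeometry.HodgeTheory.IsWeilType.hodgeConjectureFor_iff_of_hasHodgeGroupSU
    (h : HodgeTheory.IsWeilType A φ n d) (hn : 2 ≤ n) (e : ProjectiveEmbedding A.X)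
    {a : complexBetti (projectiveSpace e.n ℂ) 2} (ha : IsRationalClass a) (ha0 : a ≠ 0)
    (hSU : HasHodgeGroupSU A φ n d
      ((d : ℂ) • complexBetti.map e.ι 2 a + complexBetti.map φ.hom.hom.hom 2 (complexBetti.map e.ι 2 a))) :
    HodgeConjectureFor A.dim A.X ↔
      ∀ c ∈ weilClassesOf A φ n d, IsRationalClass c → IsOfHodgeType (2 * n) A.X (2 * n) n n c →
        c ∈ algebraicClasses A.X n := by
  refine ⟨HodgeTheory.weilClasses_algebraic_of_hodgeConjectureFor h, fun hW ↦ ?_⟩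
  have h11 : ∀ b : complexBetti A.X (2 * 1), IsRationalClass b → IsOfHodgeType A.dim A.X (2 * 1) 1 1 b →
      b ∈ algebraicClasses A.X 1 :=
    fun b hb hb' ↦ lefschetzOneOne_rational_holds (AbelianVariety.isSmoothProjective_holds (A := A)) b hb hb'
  exact HodgeTheory.hodgeConjectureFor_of_isDivisorWeilGenerated h
    (h.isDivisorWeilGenerated_of_hasHodgeGroupSU hn e ha ha0 hSU)
    (AbelianVariety.divisorClassesSpan_le_algebraicClasses A h11) hW

end Bridges







end Literature.AlgebraicGeometry.VanGeemen1994

end
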